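import Mathlib.FieldTheory.RatFunc.AsPolynomial
import Mathlib.FieldTheory.RatFunc.Degree
import Mathlib.AlgebraicGeometry.EllipticCurve.Affine.Point
import Mathlib.AlgebraicGeometry.EllipticCurve.Affine.AddSubMap
import Mathlib.AlgebraicGeometry.EllipticCurve.NormalForms
import Mathlib.FieldTheory.Finite.Basic
import Mathlib.NumberTheory.LegendreSymbol.QuadraticChar.Basic
import Mathlib.Analysis.Real.Sqrt
import Literature.NumberTheory.EllipticCurves.VariableChangePoints
import HarnessLib

/-!
# Hasse's theorem for elliptic curves over finite fields: Manin's elementary proof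

Main results (all sorry-free):

* `WeierstrassCurve.abs_natCard_point_sub_le_of_ringChar_ne`: for an elliptic curve `E` over a
  finite field `F` with `q` elements and `char F ≠ 2, 3`,
  `|#E(F) - (q + 1)| ≤ 2 √q`, where `#E(F) = Nat.card E.toAffine.Point` (affine points plus `O`).
  This is Hasse's theorem (Hasse 1936; Silverman, *AEC* Thm. V.1.1) in the characteristics needed
  by `WeierstrassCurve.LSeriesSummable_of_lt_re_of_hasseBound_of_ringChar_not_mem`
  (`Literature.NumberTheory.EllipticCurves.AnalyticRankLSeriesSummableProofs`, `S = {2, 3}`).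
* `Literature.NumberTheory.EllipticCurves.HasseElementary.hasse_of_isShortNF`: the same for `E : y² = x³ + a x + b` and `char F ≠ 2`.
* `Literature.NumberTheory.EllipticCurves.HasseElementary.trace_sq_le`: the integer form `(q + 1 - #E(F))² ≤ 4 q`.

The proof is Manin's elementary one (Manin 1956) in the corrected form given by Knapp
(*Elliptic Curves*, Princeton 1992, §X.3, Thm. 10.5 with Lemmas 10.7 and 10.8; the correction —
`d_n` is the larger of the degrees of numerator and denominator, not the degree of the numerator —
goes back to Cassels' review of Manin's paper, see Knapp's notes to Ch. X and Chahal–Osserman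
2008). Knapp treats `F = ℤ/p`; the argument is verbatim the same over any finite field of odd
characteristic, which is what is formalised here.

## Outline (as implemented)

1. `K = F(t)` (`RatFunc F`), `ℓ = t³ + a t + b` (`ell`, the image of `cubic = X³ + aX + b`), and the
   quadratic twist `twist E : y² = x³ + a ℓ² x + b ℓ³` of `E` by `ℓ` — the Weierstrass form of
   Knapp's cubic (10.13) `Y² = (X³ + aX + b)/(x³ + ax + b)` under `x = ℓ X`, `y = ℓ² Y` — with the
   points `Q = (ℓ t, ℓ²)` (Knapp's `(x, 1)`) and `frob = (ℓ t^q, ℓ^{(q+3)/2})` (Knapp's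
   `(x^p, (x³ + ax + b)^{(p-1)/2})`); the group law is Mathlib's
   (`WeierstrassCurve.Affine.Point`).
2. `pdeg P` (Knapp's `d`): `0` at `O`, otherwise `RatFunc.height (x(P)/ℓ)`, where
   `RatFunc.height r = max (deg (num r)) (deg (denom r))` (Mathlib's lowest-terms `num`/`denom`).
3. **Lemma 10.8** (`pdeg_add_Q_add_pdeg_sub_Q`): `d(P + Q) + d(P - Q) = 2 d(P) + 2` for *every*
   point `P`. For `P ∉ {O, ±Q}` the sum and product of `x(P ± Q)/ℓ` are `N₂/D₀` and `N₁/D₀`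
   (`sum_prod_addX`), where `(N₁ : N₂ : D₀)` is Mathlib's addition–subtraction map
   `WeierstrassCurve.addSubMap` of `E` at `(fX : f + gX : g)`, `x(P)/ℓ = f/g` in lowest terms;
   Mathlib's `addSubMapCoeff_condition` (the map is a morphism of `ℙ²` since `Δ ≠ 0`) shows that
   `N₁, N₂, D₀` have no common prime factor (`not_prime_dvd`) — the use of nonsingularity that
   Knapp's write-up leaves implicit —, whence `BD ~ D₀`, `AC ~ N₁`, `AD + BC ~ N₂` for
   `x(P - Q)/ℓ = A/B`, `x(P + Q)/ℓ = C/D` in lowest terms (`exists_isUnit`, Knapp (10.21)–(10.22)),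
   and Knapp's degree case analysis (a)–(d) finishes (`height_add_height`).
4. **Lemma 10.7** (`pdeg_frob_sub_Q`): `d(Frob - Q) = #E(F)`: `x(Frob - Q)/ℓ = M/(t^q - t)²` with
   `M = ℓ (ℓ^m + 1)² - (t^q + t)(t^q - t)²`, `m = (q-1)/2`, `deg M = 2q + 1`, and `t - j` divides
   `gcd(M, (t^q - t)²)` exactly `2 - #{y : y² = j³ + aj + b}` times (Euler's criterion; at the roots
   of `ℓ` the derivative `3j² + a ≠ 0` because `Δ ≠ 0`).
5. `d(Frob) = q`; `Z n = Frob + n • Q` satisfies `d(Z (n+1)) + d(Z (n-1)) = 2 d(Z n) + 2`, so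
   `d(Z n) = n² + a n + q` on `ℤ` with `a = q + 1 - #E(F)` (`pdeg_Z_eq`, Knapp (10.25)); as
   `d ≥ 0` and `q` is odd this forces `a² ≤ 4q` (`trace_sq_le`: for `a = 2k` take `n = -k`; for
   `a = 2k + 1` take `n = -k - 1`, giving `k(k+1) ≤ q` with `k(k+1)` even and `q` odd) — replacing
   Knapp's remark that two consecutive `d_n` cannot both vanish.
6. A general elliptic `E` in characteristic `≠ 2, 3` is brought to short normal form by Mathlib's
   `WeierstrassCurve.toShortNF`, with the same number of points by
   `WeierstrassCurve.VariableChange.pointEquiv`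
   (`Literature.NumberTheory.EllipticCurves.VariableChangePoints`).

Design notes. `RatFunc.height` and its lemmas are deliberate dot-notation extensions of Mathlib's
`RatFunc` namespace (Mathlib has `RatFunc.intDegree = deg num - deg denom` but no height; searched
`Mathlib/FieldTheory/RatFunc/`), and `WeierstrassCurve.abs_natCard_point_sub_le_of_ringChar_ne`
extends `WeierstrassCurve`; everything else lives in `Literature.HasseElementary`. The hypothesis
`char F ≠ 2` is essential to the method (`frob` uses `ℓ^{(q-1)/2}`, doubling `Q` needs `2 ≠ 0`);
`char F ≠ 3` enters only through the short normal form. Mathlib (this version) has no isogenies,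
degrees or Frobenius endomorphisms of elliptic curves, so the standard proof (Silverman V.1) is
out of reach; it also does not yet connect `addSubMap` with the group law (a TODO in
`Mathlib.AlgebraicGeometry.EllipticCurve.Affine.AddSubMap`), which is done here in the special
case needed (`sum_prod_addX`, `eval_addSubMap_zero/one/two`).

## References

* A. W. Knapp, *Elliptic Curves*, Mathematical Notes 40, Princeton University Press (1992),
  §X.3: Thm. 10.5, Lemmas 10.7, 10.8, (10.13)–(10.25), pp. 306–309.
* Ju. I. Manin, *On cubic congruences to a prime modulus*, Izv. Akad. Nauk SSSR Ser. Mat. 20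
  (1956) 673–678; AMS Transl. (2) 13 (1960) 1–7.
* J. W. S. Cassels, review of Manin's paper, Math. Reviews 18 (1957) 380–381.
* J. S. Chahal, B. Osserman, *The Riemann Hypothesis for Elliptic Curves*, Amer. Math. Monthly 115
  (2008) 431–442.
* J. H. Silverman, *The Arithmetic of Elliptic Curves*, 2nd ed., GTM 106 (2009), Thm. V.1.1.
-/

open Polynomial

open scoped Classical

namespace RatFunc

variable {F : Type*} [Field F]

/-- The **height** of a rational function `r ∈ F(t)`: the larger of the degrees of its numerator and
denominator in lowest terms (Mathlib's `RatFunc.num`, `RatFunc.denom`), i.e. the degree of `r` as a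
map `ℙ¹ → ℙ¹`; Knapp's `d_n` is the height of `X_n`. A deliberate extension of Mathlib's `RatFunc`
namespace. [cite: Knapp1993, §X.3, definition of `d_n`] -/
noncomputable def height (r : RatFunc F) : ℕ := max r.num.natDegree r.denom.natDegree

/-- The height of `0 = 0/1` is `0`. [folklore] -/
theorem height_zero : (0 : RatFunc F).height = 0 := by simp [height]

/-- The height of a polynomial `p = p/1` is `deg p`. [folklore] -/
theorem height_algebraMap (p : F[X]) : (algebraMap F[X] (RatFunc F) p).height = p.natDegree := by
  simp [height]

/-- The height of `t` is `1`. [folklore] -/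
theorem height_X : (X : RatFunc F).height = 1 := by simp [height]

/-- Constants have height `0`. [folklore] -/
theorem height_C (c : F) : (C c : RatFunc F).height = 0 := by simp [height]

/-- If `x = p/q` with `p, q` coprime and `q ≠ 0`, then `num x` is associate to `p` and `denom x` to `q`
(uniqueness of lowest terms up to units). [folklore] -/
theorem associated_num_denom {x : RatFunc F} {p q : F[X]} (hq : q ≠ 0) (h : IsCoprime p q)
    (hx : x = algebraMap F[X] (RatFunc F) p / algebraMap F[X] (RatFunc F) q) :
    Associated x.num p ∧ Associated x.denom q := by
  have e : x.num * q = p * x.denom := (num_mul_eq_mul_denom_iff hq).mpr hx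
  have hc := isCoprime_num_denom x
  refine ⟨associated_of_dvd_dvd ?_ ?_, associated_of_dvd_dvd ?_ ?_⟩
  · exact hc.dvd_of_dvd_mul_right (Dvd.intro q e)
  · exact h.dvd_of_dvd_mul_right (Dvd.intro x.denom e.symm)
  · exact hc.symm.dvd_of_dvd_mul_left (Dvd.intro_left p e.symm)
  · exact h.symm.dvd_of_dvd_mul_left (Dvd.intro_left x.num e)

/-- The height of a fraction `p/q` in lowest terms (`p, q` coprime, `q ≠ 0`) is
`max (deg p) (deg q)`. [folklore] -/
theorem height_eq_of_isCoprime {x : RatFunc F} {p q : F[X]} (hq : q ≠ 0) (h : IsCoprime p q)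
    (hx : x = algebraMap F[X] (RatFunc F) p / algebraMap F[X] (RatFunc F) q) :
    x.height = max p.natDegree q.natDegree := by
  obtain ⟨h₁, h₂⟩ := associated_num_denom hq h hx
  rw [height, natDegree_eq_of_degree_eq (degree_eq_degree_of_associated h₁),
    natDegree_eq_of_degree_eq (degree_eq_degree_of_associated h₂)]

end RatFunc

namespace Literature.NumberTheory.EllipticCurves.HasseElementary


variable {F : Type*} [Field F] (E : WeierstrassCurve F) [E.IsShortNF]

/-- `N₁ = (fX - a g)² - 4 b g (f + gX)`: `g²` times the numerator `(Px - aQ)² - 4bQ(Qx + P)` of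
`X_{n-1} X_{n+1}` in Knapp's (10.20) (with `P = f`, `Q = g`). [cite: Knapp1993, (10.20)] -/
noncomputable def addSubProd (f g : F[X]) : F[X] :=
  (f * X - C E.a₄ * g) ^ 2 - 4 * C E.a₆ * g * (f + g * X)

/-- `N₂ = 2((f + gX)(fX + a g) + 2 b g²)`: `g²` times the numerator of `X_{n-1} + X_{n+1}` in Knapp's
(10.19). [cite: Knapp1993, (10.19)] -/
noncomputable def addSubSum (f g : F[X]) : F[X] :=
  2 * ((f + g * X) * (f * X + C E.a₄ * g) + 2 * C E.a₆ * g ^ 2)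

/-- `D₀ = (gX - f)²`: `g²` times the common denominator `(Qx - P)²` of Knapp's (10.19), (10.20).
[cite: Knapp1993, (10.19)–(10.20)] -/
noncomputable def addSubDen (f g : F[X]) : F[X] :=
  (g * X - f) ^ 2

/-- The first component of Mathlib's addition–subtraction map of `E` at `(fX : f + gX : g)` is
`addSubProd E f g`. [folklore] -/
theorem eval_addSubMap_zero (f g : F[X]) :
    (WeierstrassCurve.addSubMap (E.map C) 0).eval ![f * X, f + g * X, g] = addSubProd E f g := by
  simp [WeierstrassCurve.addSubMap, addSubProd, map_ofNat]
  ring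

/-- The second component of Mathlib's addition–subtraction map of `E` at `(fX : f + gX : g)` is
`addSubSum E f g`. [folklore] -/
theorem eval_addSubMap_one (f g : F[X]) :
    (WeierstrassCurve.addSubMap (E.map C) 1).eval ![f * X, f + g * X, g] = addSubSum E f g := by
  simp [WeierstrassCurve.addSubMap, addSubSum, map_ofNat]
  ring

/-- The third component of Mathlib's addition–subtraction map at `(fX : f + gX : g)` is
`addSubDen f g = (gX - f)²`. [folklore] -/
theorem eval_addSubMap_two (f g : F[X]) :
    (WeierstrassCurve.addSubMap (E.map C) 2).eval ![f * X, f + g * X, g] = addSubDen f g := by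
  simp [WeierstrassCurve.addSubMap, addSubDen, map_ofNat]
  ring

variable [E.IsElliptic]

/-- `g⁴` lies in the ideal `(addSubProd, addSubSum, addSubDen)`: Mathlib's
`WeierstrassCurve.addSubMapCoeff_condition` (the addition–subtraction map is a morphism of `ℙ²`
when `Δ` is a unit), specialised to `(fX : f + gX : g)`. This is where nonsingularity of `E`
enters the proof of Knapp's Lemma 10.8. [folklore] -/
theorem exists_combination_eq_pow (f g : F[X]) :
    ∃ c₀ c₁ c₂ : F[X], c₀ * addSubProd E f g + c₁ * addSubSum E f g + c₂ * addSubDen f g = g ^ 4 := by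
  have h := WeierstrassCurve.addSubMapCoeff_condition (E.map C) ![f * X, f + g * X, g] 2
  rw [Fin.sum_univ_three, eval_addSubMap_zero, eval_addSubMap_one, eval_addSubMap_two] at h
  exact ⟨_, _, _, h⟩

/-- No prime divides all three of `N₁`, `N₂`, `D₀` when `f, g` are coprime (from
`exists_combination_eq_pow`; this needs `Δ ≠ 0`). [folklore] -/
theorem not_prime_dvd {f g : F[X]} (hfg : IsCoprime f g) {π : F[X]} (hπ : Prime π)
    (h₁ : π ∣ addSubProd E f g) (h₂ : π ∣ addSubSum E f g) (h₃ : π ∣ addSubDen f g) : False := by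
  obtain ⟨c₀, c₁, c₂, hc⟩ := exists_combination_eq_pow E f g
  have hg4 : π ∣ g ^ 4 := by
    rw [← hc]
    exact dvd_add (dvd_add (dvd_mul_of_dvd_right h₁ _) (dvd_mul_of_dvd_right h₂ _))
      (dvd_mul_of_dvd_right h₃ _)
  have hg : π ∣ g := hπ.dvd_of_dvd_pow hg4
  have hgf : π ∣ g * X - f := hπ.dvd_of_dvd_pow (n := 2) h₃
  have hf : π ∣ f := by
    have : π ∣ g * X - (g * X - f) := dvd_sub (dvd_mul_of_dvd_left hg _) hgf
    simpa using this
  exact hπ.not_unit (hfg.isUnit_of_dvd' hf hg)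

omit [E.IsShortNF] [E.IsElliptic] in
/-- `(gX - f)²` is coprime to every power of `g` when `f, g` are coprime. [folklore] -/
theorem isCoprime_addSubDen {f g : F[X]} (hfg : IsCoprime f g) (n : ℕ) :
    IsCoprime (addSubDen f g) (g ^ n) := by
  obtain ⟨u, v, huv⟩ := hfg
  have : IsCoprime (g * X - f) g := ⟨-u, v + u * X, by linear_combination huv⟩
  exact this.pow

/-- `D₀ ∣ B D` whenever `A C D₀ = N₁ B D` and `(A D + B C) D₀ = N₂ B D`: multiply a Bézout
combination `g⁴ = c₀ N₁ + c₁ N₂ + c₂ D₀` by `B D` and use that `D₀` is coprime to `g`. [folklore] -/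
theorem addSubDen_dvd {f g A B Cc D : F[X]} (hfg : IsCoprime f g)
    (e₁ : A * Cc * addSubDen f g = addSubProd E f g * (B * D))
    (e₂ : (A * D + B * Cc) * addSubDen f g = addSubSum E f g * (B * D)) :
    addSubDen f g ∣ B * D := by
  obtain ⟨c₀, c₁, c₂, hc⟩ := exists_combination_eq_pow E f g
  refine (isCoprime_addSubDen hfg 4).dvd_of_dvd_mul_right
    ⟨c₀ * (A * Cc) + c₁ * (A * D + B * Cc) + c₂ * (B * D), ?_⟩
  linear_combination (-(B * D)) * hc - c₀ * e₁ - c₁ * e₂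

omit [E.IsShortNF] [E.IsElliptic] in
/-- **Knapp's (10.21)–(10.22)**: if `A/B`, `C/D` are in lowest terms, `D₀ ∣ B D`,
`A C D₀ = N₁ B D` and `(A D + B C) D₀ = N₂ B D`, then `B D = D₀ T`, `A C = N₁ T`,
`A D + B C = N₂ T` for a *unit* `T` (a prime factor of `T` dividing `B` would divide `C`, hence
`A D`, hence `D`, contradicting `gcd(C, D) = 1`; symmetrically for `D`). [cite: Knapp1993, (10.21)] -/
theorem exists_isUnit {A B Cc D N₁ N₂ D₀ : F[X]} (hAB : IsCoprime A B) (hCD : IsCoprime Cc D)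
    (hB : B ≠ 0) (hD : D ≠ 0) (hD₀ : D₀ ≠ 0) (hdvd : D₀ ∣ B * D)
    (e₁ : A * Cc * D₀ = N₁ * (B * D)) (e₂ : (A * D + B * Cc) * D₀ = N₂ * (B * D)) :
    ∃ T : F[X], IsUnit T ∧ B * D = D₀ * T ∧ A * Cc = N₁ * T ∧ A * D + B * Cc = N₂ * T := by
  obtain ⟨T, hT⟩ := hdvd
  have hT0 : T ≠ 0 := by
    rintro rfl
    exact mul_ne_zero hB hD (by simpa using hT)
  have hAC : A * Cc = N₁ * T := by
    apply mul_right_cancel₀ hD₀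
    linear_combination e₁ + N₁ * hT
  have hADBC : A * D + B * Cc = N₂ * T := by
    apply mul_right_cancel₀ hD₀
    linear_combination e₂ + N₂ * hT
  refine ⟨T, ?_, hT, hAC, hADBC⟩
  by_contra hTu
  obtain ⟨π, hπirr, hπT⟩ := WfDvdMonoid.exists_irreducible_factor hTu hT0
  have hπ : Prime π := hπirr.prime
  have hπBD : π ∣ B * D := hT ▸ dvd_mul_of_dvd_right hπT _
  have hπAC : π ∣ A * Cc := hAC ▸ dvd_mul_of_dvd_right hπT _
  have hπS : π ∣ A * D + B * Cc := hADBC ▸ dvd_mul_of_dvd_right hπT _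
  rcases hπ.dvd_or_dvd hπBD with hπB | hπD
  · have hπA : ¬π ∣ A := fun hπA => hπ.not_unit (hAB.isUnit_of_dvd' hπA hπB)
    have hπC : π ∣ Cc := (hπ.dvd_or_dvd hπAC).resolve_left hπA
    have hπAD : π ∣ A * D := by
      have := dvd_sub hπS (dvd_mul_of_dvd_right hπC B)
      simpa using this
    have hπD : π ∣ D := (hπ.dvd_or_dvd hπAD).resolve_left hπA
    exact hπ.not_unit (hCD.isUnit_of_dvd' hπC hπD)
  · have hπC : ¬π ∣ Cc := fun hπC => hπ.not_unit (hCD.isUnit_of_dvd' hπC hπD)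
    have hπA : π ∣ A := (hπ.dvd_or_dvd hπAC).resolve_right hπC
    have hπBC : π ∣ B * Cc := by
      have := dvd_sub hπS (dvd_mul_of_dvd_left hπA D)
      simpa using this
    have hπB : π ∣ B := (hπ.dvd_or_dvd hπBC).resolve_right hπC
    exact hπ.not_unit (hAB.isUnit_of_dvd' hπA hπB)


/-! ### Degrees -/

section Degrees

omit [E.IsElliptic]

variable {f g : F[X]}

/-- `deg (n · c · p) ≤ deg p` for a numeral `n` and a constant `c`. [folklore] -/
theorem natDegree_ofNat_mul_C_mul_le (n : ℕ) [n.AtLeastTwo] (c : F) (p : F[X]) :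
    ((OfNat.ofNat n : F[X]) * C c * p).natDegree ≤ p.natDegree := by
  calc ((OfNat.ofNat n : F[X]) * C c * p).natDegree
      ≤ ((OfNat.ofNat n : F[X]) * C c).natDegree + p.natDegree := natDegree_mul_le
    _ ≤ 0 + p.natDegree := by
        gcongr
        calc ((OfNat.ofNat n : F[X]) * C c).natDegree
            ≤ (OfNat.ofNat n : F[X]).natDegree + (C c).natDegree := natDegree_mul_le
          _ = 0 := by simp
    _ = p.natDegree := zero_add _

omit [E.IsShortNF] in
/-- If `f ≠ 0` and `deg g ≤ deg f` then `deg N₁ = 2 deg f + 2` (leading term `f²X²`; Knapp, case (a)).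
[cite: Knapp1993, Lemma 10.8] -/
theorem natDegree_addSubProd_of_le (hf : f ≠ 0) (hfg : g.natDegree ≤ f.natDegree) :
    (addSubProd E f g).natDegree = 2 * f.natDegree + 2 := by
  have h1 : (f * X - C E.a₄ * g).natDegree = f.natDegree + 1 := by
    rw [natDegree_sub_eq_left_of_natDegree_lt] <;> rw [natDegree_mul_X hf]
    calc (C E.a₄ * g).natDegree ≤ g.natDegree := natDegree_C_mul_le _ _
      _ < f.natDegree + 1 := by omega
  have h2 : ((f * X - C E.a₄ * g) ^ 2).natDegree = 2 * f.natDegree + 2 := by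
    rw [natDegree_pow, h1]; ring
  have h3 : (4 * C E.a₆ * g * (f + g * X)).natDegree < 2 * f.natDegree + 2 := by
    calc (4 * C E.a₆ * g * (f + g * X)).natDegree
        ≤ (4 * C E.a₆ * g).natDegree + (f + g * X).natDegree := natDegree_mul_le
      _ ≤ g.natDegree + (f.natDegree + 1) := by
          gcongr
          · exact natDegree_ofNat_mul_C_mul_le 4 E.a₆ g
          · calc (f + g * X).natDegree ≤ max f.natDegree (g * X).natDegree := natDegree_add_le _ _
              _ ≤ f.natDegree + 1 := by
                  apply max_le (by omega)
                  calc (g * X).natDegree ≤ g.natDegree + (X : F[X]).natDegree := natDegree_mul_le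
                    _ ≤ g.natDegree + 1 := by gcongr; exact natDegree_X_le
                    _ ≤ f.natDegree + 1 := by omega
      _ < 2 * f.natDegree + 2 := by omega
  rw [addSubProd, natDegree_sub_eq_left_of_natDegree_lt (h2 ▸ h3), h2]

/-- If `deg g ≤ deg f` then `deg D₀ ≤ 2 deg f + 2`. [cite: Knapp1993, Lemma 10.8] -/
theorem natDegree_addSubDen_le_of_le (hfg : g.natDegree ≤ f.natDegree) :
    (addSubDen f g).natDegree ≤ 2 * f.natDegree + 2 := by
  rw [addSubDen]
  calc ((g * X - f) ^ 2).natDegree ≤ 2 * (g * X - f).natDegree := natDegree_pow_le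
    _ ≤ 2 * (f.natDegree + 1) := by
        gcongr
        calc (g * X - f).natDegree ≤ max (g * X).natDegree f.natDegree := natDegree_sub_le _ _
          _ ≤ f.natDegree + 1 := by
              apply max_le _ (by omega)
              calc (g * X).natDegree ≤ g.natDegree + (X : F[X]).natDegree := natDegree_mul_le
                _ ≤ g.natDegree + 1 := by gcongr; exact natDegree_X_le
                _ ≤ f.natDegree + 1 := by omega
    _ = 2 * f.natDegree + 2 := by ring

omit [E.IsShortNF] in
/-- If `deg g ≤ deg f` then `deg N₂ ≤ 2 deg f + 2`. [cite: Knapp1993, Lemma 10.8] -/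
theorem natDegree_addSubSum_le_of_le (hfg : g.natDegree ≤ f.natDegree) :
    (addSubSum E f g).natDegree ≤ 2 * f.natDegree + 2 := by
  have hgX : (g * X).natDegree ≤ f.natDegree + 1 := by
    calc (g * X).natDegree ≤ g.natDegree + (X : F[X]).natDegree := natDegree_mul_le
      _ ≤ g.natDegree + 1 := by gcongr; exact natDegree_X_le
      _ ≤ f.natDegree + 1 := by omega
  have hfX : (f * X).natDegree ≤ f.natDegree + 1 := by
    calc (f * X).natDegree ≤ f.natDegree + (X : F[X]).natDegree := natDegree_mul_le
      _ ≤ f.natDegree + 1 := by gcongr; exact natDegree_X_le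
  rw [addSubSum]
  calc (2 * ((f + g * X) * (f * X + C E.a₄ * g) + 2 * C E.a₆ * g ^ 2)).natDegree
      ≤ (2 : F[X]).natDegree + ((f + g * X) * (f * X + C E.a₄ * g) + 2 * C E.a₆ * g ^ 2).natDegree :=
        natDegree_mul_le
    _ ≤ 0 + (2 * f.natDegree + 2) := by
        gcongr
        · simp
        calc ((f + g * X) * (f * X + C E.a₄ * g) + 2 * C E.a₆ * g ^ 2).natDegree
            ≤ max ((f + g * X) * (f * X + C E.a₄ * g)).natDegree (2 * C E.a₆ * g ^ 2).natDegree :=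
              natDegree_add_le _ _
          _ ≤ 2 * f.natDegree + 2 := by
              apply max_le
              · calc ((f + g * X) * (f * X + C E.a₄ * g)).natDegree
                    ≤ (f + g * X).natDegree + (f * X + C E.a₄ * g).natDegree := natDegree_mul_le
                  _ ≤ (f.natDegree + 1) + (f.natDegree + 1) := by
                      gcongr
                      · exact (natDegree_add_le _ _).trans (max_le (by omega) hgX)
                      · exact (natDegree_add_le _ _).trans
                          (max_le hfX ((natDegree_C_mul_le _ _).trans (by omega)))
                  _ = 2 * f.natDegree + 2 := by ring
              · calc (2 * C E.a₆ * g ^ 2).natDegree ≤ (g ^ 2).natDegree := by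
                      exact natDegree_ofNat_mul_C_mul_le 2 E.a₆ (g ^ 2)
                  _ ≤ 2 * g.natDegree := natDegree_pow_le
                  _ ≤ 2 * f.natDegree + 2 := by omega
    _ = 2 * f.natDegree + 2 := zero_add _

/-- If `f = 0` or `deg f < deg g` then `deg D₀ = 2 deg g + 2` (leading term `g²X²`; Knapp, case (b)).
[cite: Knapp1993, Lemma 10.8] -/
theorem natDegree_addSubDen_of_lt (hg : g ≠ 0) (hfg : f = 0 ∨ f.natDegree < g.natDegree) :
    (addSubDen f g).natDegree = 2 * g.natDegree + 2 := by
  have h1 : (g * X - f).natDegree = g.natDegree + 1 := by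
    rw [natDegree_sub_eq_left_of_natDegree_lt] <;> rw [natDegree_mul_X hg]
    rcases hfg with rfl | h
    · simp
    · omega
  rw [addSubDen, natDegree_pow, h1]; ring

omit [E.IsShortNF] in
/-- If `f = 0` or `deg f < deg g` then `deg N₁ ≤ 2 deg g + 1`. [cite: Knapp1993, Lemma 10.8] -/
theorem natDegree_addSubProd_le_of_lt (hfg : f = 0 ∨ f.natDegree < g.natDegree) :
    (addSubProd E f g).natDegree ≤ 2 * g.natDegree + 1 := by
  have hf : f.natDegree ≤ g.natDegree := by
    rcases hfg with rfl | h
    · simp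
    · omega
  have hfX : (f * X).natDegree ≤ g.natDegree := by
    rcases hfg with rfl | h
    · simp
    · by_cases hf0 : f = 0
      · simp [hf0]
      · rw [natDegree_mul_X hf0]; omega
  have hgX : (g * X).natDegree ≤ g.natDegree + 1 := by
    calc (g * X).natDegree ≤ g.natDegree + (X : F[X]).natDegree := natDegree_mul_le
      _ ≤ g.natDegree + 1 := by gcongr; exact natDegree_X_le
  rw [addSubProd]
  calc ((f * X - C E.a₄ * g) ^ 2 - 4 * C E.a₆ * g * (f + g * X)).natDegree
      ≤ max ((f * X - C E.a₄ * g) ^ 2).natDegree (4 * C E.a₆ * g * (f + g * X)).natDegree :=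
        natDegree_sub_le _ _
    _ ≤ 2 * g.natDegree + 1 := by
        apply max_le
        · calc ((f * X - C E.a₄ * g) ^ 2).natDegree ≤ 2 * (f * X - C E.a₄ * g).natDegree :=
                natDegree_pow_le
            _ ≤ 2 * g.natDegree := by
                gcongr
                exact (natDegree_sub_le _ _).trans (max_le hfX (natDegree_C_mul_le _ _))
            _ ≤ 2 * g.natDegree + 1 := by omega
        · calc (4 * C E.a₆ * g * (f + g * X)).natDegree
              ≤ (4 * C E.a₆ * g).natDegree + (f + g * X).natDegree := natDegree_mul_le
            _ ≤ g.natDegree + (g.natDegree + 1) := by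
                gcongr
                · exact natDegree_ofNat_mul_C_mul_le 4 E.a₆ g
                · exact (natDegree_add_le _ _).trans (max_le (by omega) hgX)
            _ = 2 * g.natDegree + 1 := by ring

omit [E.IsShortNF] in
/-- If `f = 0` or `deg f < deg g` then `deg N₂ ≤ 2 deg g + 1`. [cite: Knapp1993, Lemma 10.8] -/
theorem natDegree_addSubSum_le_of_lt (hfg : f = 0 ∨ f.natDegree < g.natDegree) :
    (addSubSum E f g).natDegree ≤ 2 * g.natDegree + 1 := by
  have hf : f.natDegree ≤ g.natDegree := by
    rcases hfg with rfl | h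
    · simp
    · omega
  have hfX : (f * X).natDegree ≤ g.natDegree := by
    rcases hfg with rfl | h
    · simp
    · by_cases hf0 : f = 0
      · simp [hf0]
      · rw [natDegree_mul_X hf0]; omega
  have hgX : (g * X).natDegree ≤ g.natDegree + 1 := by
    calc (g * X).natDegree ≤ g.natDegree + (X : F[X]).natDegree := natDegree_mul_le
      _ ≤ g.natDegree + 1 := by gcongr; exact natDegree_X_le
  rw [addSubSum]
  calc (2 * ((f + g * X) * (f * X + C E.a₄ * g) + 2 * C E.a₆ * g ^ 2)).natDegree
      ≤ (2 : F[X]).natDegree + ((f + g * X) * (f * X + C E.a₄ * g) + 2 * C E.a₆ * g ^ 2).natDegree :=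
        natDegree_mul_le
    _ ≤ 0 + (2 * g.natDegree + 1) := by
        gcongr
        · simp
        calc ((f + g * X) * (f * X + C E.a₄ * g) + 2 * C E.a₆ * g ^ 2).natDegree
            ≤ max ((f + g * X) * (f * X + C E.a₄ * g)).natDegree (2 * C E.a₆ * g ^ 2).natDegree :=
              natDegree_add_le _ _
          _ ≤ 2 * g.natDegree + 1 := by
              apply max_le
              · calc ((f + g * X) * (f * X + C E.a₄ * g)).natDegree
                    ≤ (f + g * X).natDegree + (f * X + C E.a₄ * g).natDegree := natDegree_mul_le
                  _ ≤ (g.natDegree + 1) + g.natDegree := by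
                      gcongr
                      · exact (natDegree_add_le _ _).trans (max_le (by omega) hgX)
                      · exact (natDegree_add_le _ _).trans
                          (max_le hfX (natDegree_C_mul_le _ _))
                  _ = 2 * g.natDegree + 1 := by ring
              · calc (2 * C E.a₆ * g ^ 2).natDegree ≤ (g ^ 2).natDegree := by
                      exact natDegree_ofNat_mul_C_mul_le 2 E.a₆ (g ^ 2)
                  _ ≤ 2 * g.natDegree := natDegree_pow_le
                  _ ≤ 2 * g.natDegree + 1 := by omega
    _ = 2 * g.natDegree + 1 := zero_add _

end Degrees

/-! ### The case analysis on degrees -/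

section Combinatorics

omit [E.IsShortNF] [E.IsElliptic]

/-- Knapp's case analysis (a)–(d) in the proof of Lemma 10.8, regime `deg f ≥ deg g`: if
`deg (AC) = H`, `deg (BD) ≤ H` and `deg (AD + BC) ≤ H` then
`max (deg A) (deg B) + max (deg C) (deg D) = H`. [cite: Knapp1993, Lemma 10.8] -/
theorem max_add_max_of_eq_of_le {A B Cc D : F[X]} (hA : A ≠ 0) (hB : B ≠ 0) (hC : Cc ≠ 0)
    (hD : D ≠ 0) {H : ℕ} (hAC : (A * Cc).natDegree = H) (hBD : (B * D).natDegree ≤ H)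
    (hS : (A * D + B * Cc).natDegree ≤ H) :
    max A.natDegree B.natDegree + max Cc.natDegree D.natDegree = H := by
  rw [natDegree_mul hA hC] at hAC
  rw [natDegree_mul hB hD] at hBD
  have hAD := natDegree_mul hA hD
  have hBC := natDegree_mul hB hC
  rcases le_or_gt B.natDegree A.natDegree with h1 | h1 <;>
    rcases le_or_gt D.natDegree Cc.natDegree with h2 | h2
  · rw [max_eq_left h1, max_eq_left h2]; exact hAC
  · exfalso
    have : (A * D + B * Cc).natDegree = A.natDegree + D.natDegree := by
      rw [natDegree_add_eq_left_of_natDegree_lt] <;> omega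
    omega
  · exfalso
    have : (A * D + B * Cc).natDegree = B.natDegree + Cc.natDegree := by
      rw [natDegree_add_eq_right_of_natDegree_lt] <;> omega
    omega
  · exfalso
    omega

/-- Knapp's case analysis (a)–(d) in the proof of Lemma 10.8, regime `deg f < deg g`: if
`deg (BD) = H`, `deg (AC) < H` and `deg (AD + BC) < H` (or these vanish) then
`max (deg A) (deg B) + max (deg C) (deg D) = H`. [cite: Knapp1993, Lemma 10.8] -/
theorem max_add_max_of_lt_of_eq {A B Cc D : F[X]} (hB : B ≠ 0) (hD : D ≠ 0) {H : ℕ}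
    (hBD : (B * D).natDegree = H) (hAC : A * Cc = 0 ∨ (A * Cc).natDegree < H)
    (hS : A * D + B * Cc = 0 ∨ (A * D + B * Cc).natDegree < H) :
    max A.natDegree B.natDegree + max Cc.natDegree D.natDegree = H := by
  rw [natDegree_mul hB hD] at hBD
  rcases le_or_gt A.natDegree B.natDegree with h1 | h1 <;>
    rcases le_or_gt Cc.natDegree D.natDegree with h2 | h2
  · rw [max_eq_right h1, max_eq_right h2]; exact hBD
  · exfalso
    have hC : Cc ≠ 0 := by rintro rfl; simp at h2
    have hBC := natDegree_mul hB hC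
    have key : (A * D + B * Cc).natDegree = B.natDegree + Cc.natDegree := by
      by_cases hA : A = 0
      · simp [hA, hBC]
      · rw [natDegree_add_eq_right_of_natDegree_lt]
        · exact hBC
        · rw [natDegree_mul hA hD, hBC]; omega
    rcases hS with hS | hS
    · rw [hS] at key; simp at key; omega
    · omega
  · exfalso
    have hA : A ≠ 0 := by rintro rfl; simp at h1
    have hAD := natDegree_mul hA hD
    have key : (A * D + B * Cc).natDegree = A.natDegree + D.natDegree := by
      by_cases hC : Cc = 0
      · simp [hC, hAD]
      · rw [natDegree_add_eq_left_of_natDegree_lt]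
        · exact hAD
        · rw [natDegree_mul hB hC, hAD]; omega
    rcases hS with hS | hS
    · rw [hS] at key; simp at key; omega
    · omega
  · exfalso
    have hA : A ≠ 0 := by rintro rfl; simp at h1
    have hC : Cc ≠ 0 := by rintro rfl; simp at h2
    rcases hAC with hAC | hAC
    · exact mul_ne_zero hA hC hAC
    · rw [natDegree_mul hA hC] at hAC; omega

end Combinatorics


/-! ### The parallelogram identity for heights -/

section Assembly

omit [E.IsShortNF] [E.IsElliptic]

/-- `num r = r · denom r` in `F(t)`. [folklore] -/
theorem algebraMap_num_eq (x : RatFunc F) :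
    algebraMap F[X] (RatFunc F) x.num = x * algebraMap F[X] (RatFunc F) x.denom :=
  (div_eq_iff (RatFunc.algebraMap_ne_zero x.denom_ne_zero)).mp (RatFunc.num_div_denom x)

end Assembly

variable {E}

/-- **The algebraic core of Knapp's Lemma 10.8.** Let `x, x₊, x₋ ∈ F(t)` with `x ≠ t`,
`(x₊ + x₋)(x - t)² = 2((x + t)(x t + a) + 2b)` and `x₊ x₋ (x - t)² = (x t - a)² - 4b(x + t)` (the sum and
product of the `x`-coordinates of `P ± Q` on `y² = x³ + a x + b`, `x = x(P)`, `t = x(Q)`), and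
assume `Δ ≠ 0`. Then `h(x₊) + h(x₋) = 2 h(x) + 2` for the height `h`. Proof: with `x = f/g`,
`x₋ = A/B`, `x₊ = C/D` in lowest terms, `A C D₀ = N₁ B D` and `(A D + B C) D₀ = N₂ B D`
(`e₁`, `e₂`); by `addSubDen_dvd` and `exists_isUnit`, `deg (B D) = deg D₀`, `deg (A C) = deg N₁`,
`deg (A D + B C) = deg N₂`; conclude by the degree bounds and `max_add_max_of_eq_of_le` /
`max_add_max_of_lt_of_eq`. [cite: Knapp1993, Lemma 10.8] -/
theorem height_add_height {x xp xm : RatFunc F} (hx : x ≠ RatFunc.X)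
    (hsum : (xp + xm) * (x - RatFunc.X) ^ 2 =
      2 * ((x + RatFunc.X) * (x * RatFunc.X + RatFunc.C E.a₄) + 2 * RatFunc.C E.a₆))
    (hprod : xp * xm * (x - RatFunc.X) ^ 2 =
      (x * RatFunc.X - RatFunc.C E.a₄) ^ 2 - 4 * RatFunc.C E.a₆ * (x + RatFunc.X)) :
    xp.height + xm.height = 2 * x.height + 2 := by
  -- numerators and denominators
  have hf := algebraMap_num_eq x
  have hA := algebraMap_num_eq xm
  have hC := algebraMap_num_eq xp
  set f := x.num with hfdef
  set g := x.denom with hgdef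
  set A := xm.num with hAdef
  set B := xm.denom with hBdef
  set Cc := xp.num with hCdef
  set D := xp.denom with hDdef
  have hg0 : g ≠ 0 := x.denom_ne_zero
  have hB0 : B ≠ 0 := xm.denom_ne_zero
  have hD0 : D ≠ 0 := xp.denom_ne_zero
  have hfg : IsCoprime f g := x.isCoprime_num_denom
  have hAB : IsCoprime A B := xm.isCoprime_num_denom
  have hCD : IsCoprime Cc D := xp.isCoprime_num_denom
  have hinj := RatFunc.algebraMap_injective F
  -- `g X - f ≠ 0`
  have hgXf : g * X - f ≠ 0 := by
    intro h
    apply hx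
    have h' : algebraMap F[X] (RatFunc F) f = algebraMap F[X] (RatFunc F) (g * X) := by
      rw [sub_eq_zero.mp h]
    rw [hf, map_mul, RatFunc.algebraMap_X] at h'
    have hg' : algebraMap F[X] (RatFunc F) g ≠ 0 := RatFunc.algebraMap_ne_zero hg0
    calc x = x * algebraMap F[X] (RatFunc F) g / algebraMap F[X] (RatFunc F) g := by field_simp
      _ = RatFunc.X := by rw [h', mul_div_cancel_left₀ _ hg']
  have hden0 : addSubDen f g ≠ 0 := pow_ne_zero 2 hgXf
  -- the two polynomial identities
  have e₁ : A * Cc * addSubDen f g = addSubProd E f g * (B * D) := by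
    apply hinj
    simp only [map_mul, map_sub, map_add, map_pow, addSubDen, addSubProd, RatFunc.algebraMap_X,
      RatFunc.algebraMap_C, hf, hA, hC, map_ofNat]
    linear_combination
      (algebraMap F[X] (RatFunc F) B * algebraMap F[X] (RatFunc F) D *
        algebraMap F[X] (RatFunc F) g ^ 2) * hprod
  have e₂ : (A * D + B * Cc) * addSubDen f g = addSubSum E f g * (B * D) := by
    apply hinj
    simp only [map_mul, map_sub, map_add, map_pow, addSubDen, addSubSum, RatFunc.algebraMap_X,
      RatFunc.algebraMap_C, hf, hA, hC, map_ofNat]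
    linear_combination
      (algebraMap F[X] (RatFunc F) B * algebraMap F[X] (RatFunc F) D *
        algebraMap F[X] (RatFunc F) g ^ 2) * hsum
  -- the unit
  obtain ⟨T, hT, hBD, hAC, hS⟩ := exists_isUnit hAB hCD hB0 hD0 hden0
    (addSubDen_dvd E hfg e₁ e₂) e₁ e₂
  obtain ⟨c, hc, rfl⟩ := Polynomial.isUnit_iff.mp hT
  have hc0 : c ≠ 0 := hc.ne_zero
  have dBD : (B * D).natDegree = (addSubDen f g).natDegree := by rw [hBD, natDegree_mul_C hc0]
  have dAC : (A * Cc).natDegree = (addSubProd E f g).natDegree := by rw [hAC, natDegree_mul_C hc0]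
  have dS : (A * D + B * Cc).natDegree = (addSubSum E f g).natDegree := by
    rw [hS, natDegree_mul_C hc0]
  -- heights
  simp only [RatFunc.height]
  rw [← hfdef, ← hgdef, ← hAdef, ← hBdef, ← hCdef, ← hDdef]
  rcases em (f ≠ 0 ∧ g.natDegree ≤ f.natDegree) with ⟨hf0, hle⟩ | hlt
  · -- Regime I
    rw [max_eq_left hle]
    have hprod0 : addSubProd E f g ≠ 0 := by
      intro h0
      have := natDegree_addSubProd_of_le E hf0 hle
      rw [h0, natDegree_zero] at this
      omega
    have hAC0 : A * Cc ≠ 0 := by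
      rw [hAC]; exact mul_ne_zero hprod0 (by simpa using hc0)
    rw [add_comm]
    refine max_add_max_of_eq_of_le (left_ne_zero_of_mul hAC0) hB0 (right_ne_zero_of_mul hAC0) hD0
      (dAC.trans (natDegree_addSubProd_of_le E hf0 hle)) ?_ ?_
    · exact dBD.trans_le (natDegree_addSubDen_le_of_le hle)
    · exact dS.trans_le (natDegree_addSubSum_le_of_le E hle)
  · -- Regime II
    have hlt' : f = 0 ∨ f.natDegree < g.natDegree := by
      by_cases hf0 : f = 0
      · exact Or.inl hf0
      · right; by_contra hle; exact hlt ⟨hf0, not_lt.mp hle⟩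
    have hmax : max f.natDegree g.natDegree = g.natDegree := by
      rcases hlt' with h | h
      · simp [h]
      · exact max_eq_right h.le
    rw [hmax, add_comm]
    refine max_add_max_of_lt_of_eq hB0 hD0 (dBD.trans (natDegree_addSubDen_of_lt hg0 hlt')) ?_ ?_
    · by_cases h0 : A * Cc = 0
      · exact Or.inl h0
      · right
        rw [dAC]
        have := natDegree_addSubProd_le_of_lt E (g := g) hlt'
        omega
    · by_cases h0 : A * D + B * Cc = 0
      · exact Or.inl h0
      · right
        rw [dS]
        have := natDegree_addSubSum_le_of_lt E (g := g) hlt'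
        omega




variable {F : Type*} [Field F] (E : WeierstrassCurve F)

/-- `ℓ = t³ + a t + b ∈ F(t)`, the twisting scalar (Knapp's `x³ + ax + b` in the variable `x`).
[cite: Knapp1993, (10.13)] -/
noncomputable def ell : RatFunc F := RatFunc.X ^ 3 + RatFunc.C E.a₄ * RatFunc.X + RatFunc.C E.a₆

/-- The polynomial `X³ + aX + b ∈ F[X]`. [folklore] -/
noncomputable def cubic : F[X] := X ^ 3 + C E.a₄ * X + C E.a₆

/-- `ℓ ∈ F(t)` is the image of the polynomial `X³ + aX + b`. [folklore] -/
theorem algebraMap_cubic : algebraMap F[X] (RatFunc F) (cubic E) = ell E := by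
  simp [cubic, ell]

/-- `X³ + aX + b` is monic. [folklore] -/
theorem monic_cubic : (cubic E).Monic := by
  rw [cubic]; monicity!

/-- `X³ + aX + b` has degree `3`. [folklore] -/
theorem natDegree_cubic : (cubic E).natDegree = 3 := by
  rw [cubic]; compute_degree!

/-- `X³ + aX + b ≠ 0`. [folklore] -/
theorem cubic_ne_zero : cubic E ≠ 0 := (monic_cubic E).ne_zero

/-- `ℓ ≠ 0` in `F(t)`. [folklore] -/
theorem ell_ne_zero : ell E ≠ 0 := by
  rw [← algebraMap_cubic]
  exact RatFunc.algebraMap_ne_zero (cubic_ne_zero E)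

/-- The quadratic twist `y² = x³ + a ℓ² x + b ℓ³` of `E : y² = x³ + a x + b` by `ℓ`, over `F(t)`: the
Weierstrass form of Knapp's nonsingular cubic (10.13) `Y² = (X³ + aX + b)/(x³ + ax + b)`
(`x = ℓ X`, `y = ℓ² Y`). [cite: Knapp1993, (10.13)] -/
noncomputable def twist : WeierstrassCurve (RatFunc F) :=
  ⟨0, 0, 0, RatFunc.C E.a₄ * ell E ^ 2, RatFunc.C E.a₆ * ell E ^ 3⟩

/-- The twist is in short Weierstrass form (`a₁ = a₂ = a₃ = 0`). [folklore] -/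
instance : (twist E).IsShortNF := ⟨rfl, rfl, rfl⟩

/-- The twist has `a₁ = 0`. [folklore] -/
@[simp] theorem twist_a₁ : (twist E).a₁ = 0 := rfl
/-- The twist has `a₂ = 0`. [folklore] -/
@[simp] theorem twist_a₂ : (twist E).a₂ = 0 := rfl
/-- The twist has `a₃ = 0`. [folklore] -/
@[simp] theorem twist_a₃ : (twist E).a₃ = 0 := rfl
/-- The twist has `a₄ = a ℓ²`. [folklore] -/
@[simp] theorem twist_a₄ : (twist E).a₄ = RatFunc.C E.a₄ * ell E ^ 2 := rfl
/-- The twist has `a₆ = b ℓ³`. [folklore] -/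
@[simp] theorem twist_a₆ : (twist E).a₆ = RatFunc.C E.a₆ * ell E ^ 3 := rfl

/-- The equation of the twist: `y² = x³ + a ℓ² x + b ℓ³` (Knapp's (10.13) `Y² = (X³ + aX + b)/(x³ + ax + b)`
in the coordinates `x = ℓ X`, `y = ℓ² Y`). [cite: Knapp1993, (10.13)] -/
theorem twist_equation_iff (x y : RatFunc F) : (twist E).toAffine.Equation x y ↔
    y ^ 2 = x ^ 3 + RatFunc.C E.a₄ * ell E ^ 2 * x + RatFunc.C E.a₆ * ell E ^ 3 := by
  rw [WeierstrassCurve.Affine.equation_iff]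
  simp [twist]

variable [E.IsShortNF]

/-- The discriminant of the twist is `ℓ⁶ Δ(E)`. [folklore] -/
theorem twist_Δ : (twist E).Δ = ell E ^ 6 * RatFunc.C E.Δ := by
  rw [(twist E).Δ_of_isShortNF, E.Δ_of_isShortNF]
  simp only [twist_a₄, twist_a₆, map_mul, map_neg, map_add, map_pow, map_ofNat]
  ring

variable [E.IsElliptic]

/-- The twist of an elliptic curve is nonsingular: `Δ ≠ 0`. [folklore] -/
theorem twist_Δ_ne_zero : (twist E).Δ ≠ 0 := by
  rw [twist_Δ]
  refine mul_ne_zero (pow_ne_zero _ (ell_ne_zero E)) ?_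
  rw [← RatFunc.algebraMap_eq_C]
  exact (map_ne_zero_iff _ (algebraMap F (RatFunc F)).injective).mpr E.Δ'.ne_zero

/-- On the twist (which is nonsingular) every solution of the equation is a nonsingular point.
[folklore] -/
theorem twist_nonsingular_iff (x y : RatFunc F) : (twist E).toAffine.Nonsingular x y ↔
    y ^ 2 = x ^ 3 + RatFunc.C E.a₄ * ell E ^ 2 * x + RatFunc.C E.a₆ * ell E ^ 3 := by
  rw [← WeierstrassCurve.Affine.equation_iff_nonsingular_of_Δ_ne_zero (twist_Δ_ne_zero E),
    twist_equation_iff]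

/-- `Q = (ℓ t, ℓ²)` lies on the twist (Knapp's solution `(X, Y) = (x, 1)` of (10.13)).
[cite: Knapp1993, (10.13)] -/
theorem nonsingular_Q : (twist E).toAffine.Nonsingular (ell E * RatFunc.X) (ell E ^ 2) := by
  rw [twist_nonsingular_iff, ell]; ring


/-- The point `Q = (ℓ t, ℓ²)` of the twist (Knapp's `(x, 1)`). [cite: Knapp1993, (10.14)] -/
noncomputable def Q : (twist E).toAffine.Point := .some _ _ (nonsingular_Q E)

omit [E.IsShortNF] [E.IsElliptic] in
/-- Knapp's `d`: `d(O) = 0`, and for `P = (x, y)` the larger of the degrees of numerator and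
denominator of `X = x/ℓ` in lowest terms. [cite: Knapp1993, §X.3, definition of `d_n`] -/
noncomputable def pdeg : (twist E).toAffine.Point → ℕ
  | .zero => 0
  | .some x _ _ => (x / ell E).height

omit [E.IsShortNF] [E.IsElliptic] in
/-- `d(O) = 0` by definition. [cite: Knapp1993, §X.3, definition of `d_n`] -/
@[simp] theorem pdeg_zero : pdeg E 0 = 0 := rfl

omit [E.IsShortNF] [E.IsElliptic] in
/-- `d(x, y) = height (x/ℓ)`, the larger of the degrees of numerator and denominator of Knapp's
`X = x/ℓ` in lowest terms. [cite: Knapp1993, §X.3, definition of `d_n`] -/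
@[simp] theorem pdeg_some {x y : RatFunc F} (h : (twist E).toAffine.Nonsingular x y) :
    pdeg E (.some x y h) = (x / ell E).height := rfl

omit [E.IsShortNF] [E.IsElliptic] in
/-- `d(-P) = d(P)` (same `x`-coordinate). [folklore] -/
theorem pdeg_neg (P : (twist E).toAffine.Point) : pdeg E (-P) = pdeg E P := by
  rcases P with _ | ⟨_, _, _⟩ <;> rfl

/-- `d(Q) = 1` (`x(Q)/ℓ = t`). [cite: Knapp1993, proof of Lemma 10.8] -/
theorem pdeg_Q : pdeg E (Q E) = 1 := by
  rw [Q, pdeg_some, mul_div_cancel_left₀ _ (ell_ne_zero E), RatFunc.height_X]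

/-- `d(-Q) = 1`. [cite: Knapp1993, proof of Lemma 10.8] -/
theorem pdeg_neg_Q : pdeg E (-Q E) = 1 := by rw [pdeg_neg, pdeg_Q]


/-! ### Explicit formulas -/

section Formulas

variable {E}

/-- In the coordinates `x = ℓ X'`, `y = ℓ² Y'` the twist is Knapp's `ℓ Y'² = X'³ + a X' + b`.
[cite: Knapp1993, (10.13)] -/
theorem twist_nonsingular_iff' (X' Y' : RatFunc F) :
    (twist E).toAffine.Nonsingular (ell E * X') (ell E ^ 2 * Y') ↔
      ell E * Y' ^ 2 = X' ^ 3 + RatFunc.C E.a₄ * X' + RatFunc.C E.a₆ := by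
  rw [twist_nonsingular_iff]
  constructor
  · intro h
    apply mul_left_cancel₀ (pow_ne_zero 3 (ell_ne_zero E))
    linear_combination h
  · intro h
    linear_combination (ell E) ^ 3 * h

omit [E.IsShortNF] [E.IsElliptic] in
/-- `x(P + Q)/ℓ = ℓ (Y' - 1)²/(X' - t)² - (X' + t)` for `P = (ℓ X', ℓ² Y')`, `X' ≠ t` (Knapp's (10.18),
second formula). [cite: Knapp1993, (10.18)] -/
theorem addX_Q_div {X' : RatFunc F} (Y' : RatFunc F) (hX : X' ≠ RatFunc.X) :
    (twist E).toAffine.addX (ell E * X') (ell E * RatFunc.X)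
        ((twist E).toAffine.slope (ell E * X') (ell E * RatFunc.X) (ell E ^ 2 * Y') (ell E ^ 2)) /
          ell E =
      ell E * (Y' - 1) ^ 2 / (X' - RatFunc.X) ^ 2 - (X' + RatFunc.X) := by
  have hne : ell E * X' ≠ ell E * RatFunc.X := fun h => hX (mul_left_cancel₀ (ell_ne_zero E) h)
  rw [WeierstrassCurve.Affine.slope_of_X_ne hne]
  simp only [WeierstrassCurve.Affine.addX, twist_a₁, twist_a₂]
  have hXt : X' - RatFunc.X ≠ 0 := sub_ne_zero.mpr hX
  have hℓ := ell_ne_zero E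
  field_simp
  ring

omit [E.IsShortNF] [E.IsElliptic] in
/-- `x(P - Q)/ℓ = ℓ (Y' + 1)²/(X' - t)² - (X' + t)` for `P = (ℓ X', ℓ² Y')`, `X' ≠ t` (Knapp's (10.18),
first formula). [cite: Knapp1993, (10.18)] -/
theorem addX_negQ_div {X' : RatFunc F} (Y' : RatFunc F) (hX : X' ≠ RatFunc.X) :
    (twist E).toAffine.addX (ell E * X') (ell E * RatFunc.X)
        ((twist E).toAffine.slope (ell E * X') (ell E * RatFunc.X) (ell E ^ 2 * Y')
          ((twist E).toAffine.negY (ell E * RatFunc.X) (ell E ^ 2))) / ell E =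
      ell E * (Y' + 1) ^ 2 / (X' - RatFunc.X) ^ 2 - (X' + RatFunc.X) := by
  have hne : ell E * X' ≠ ell E * RatFunc.X := fun h => hX (mul_left_cancel₀ (ell_ne_zero E) h)
  rw [WeierstrassCurve.Affine.slope_of_X_ne hne]
  simp only [WeierstrassCurve.Affine.addX, WeierstrassCurve.Affine.negY, twist_a₁, twist_a₂,
    twist_a₃]
  have hXt : X' - RatFunc.X ≠ 0 := sub_ne_zero.mpr hX
  have hℓ := ell_ne_zero E
  field_simp
  ring

omit [E.IsShortNF] [E.IsElliptic] in
/-- Knapp's (10.19) and (10.20): on `ℓ Y'² = X'³ + a X' + b`, the sum and the product of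
`x(P ± Q)/ℓ` are `2((X' + t)(X' t + a) + 2b)/(X' - t)²` and `((X' t - a)² - 4b(X' + t))/(X' - t)²`.
[cite: Knapp1993, (10.19)–(10.20)] -/
theorem sum_prod_addX {X' Y' : RatFunc F} (hX : X' ≠ RatFunc.X)
    (hcurve : ell E * Y' ^ 2 = X' ^ 3 + RatFunc.C E.a₄ * X' + RatFunc.C E.a₆) :
    (ell E * (Y' - 1) ^ 2 / (X' - RatFunc.X) ^ 2 - (X' + RatFunc.X) +
          (ell E * (Y' + 1) ^ 2 / (X' - RatFunc.X) ^ 2 - (X' + RatFunc.X))) *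
        (X' - RatFunc.X) ^ 2 =
      2 * ((X' + RatFunc.X) * (X' * RatFunc.X + RatFunc.C E.a₄) + 2 * RatFunc.C E.a₆) ∧
    (ell E * (Y' - 1) ^ 2 / (X' - RatFunc.X) ^ 2 - (X' + RatFunc.X)) *
          (ell E * (Y' + 1) ^ 2 / (X' - RatFunc.X) ^ 2 - (X' + RatFunc.X)) *
        (X' - RatFunc.X) ^ 2 =
      (X' * RatFunc.X - RatFunc.C E.a₄) ^ 2 - 4 * RatFunc.C E.a₆ * (X' + RatFunc.X) := by
  simp only [ell] at hcurve ⊢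
  set t : RatFunc F := RatFunc.X with ht
  set a : RatFunc F := RatFunc.C E.a₄ with ha
  set b : RatFunc F := RatFunc.C E.a₆ with hb
  have hXt : (X' - t) ^ 2 ≠ 0 := pow_ne_zero 2 (sub_ne_zero.mpr hX)
  set xp := (t ^ 3 + a * t + b) * (Y' - 1) ^ 2 / (X' - t) ^ 2 - (X' + t) with hxp
  set xm := (t ^ 3 + a * t + b) * (Y' + 1) ^ 2 / (X' - t) ^ 2 - (X' + t) with hxm
  have hp : xp * (X' - t) ^ 2 = (t ^ 3 + a * t + b) * (Y' - 1) ^ 2 - (X' + t) * (X' - t) ^ 2 := by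
    rw [hxp, sub_mul, div_mul_cancel₀ _ hXt]
  have hm : xm * (X' - t) ^ 2 = (t ^ 3 + a * t + b) * (Y' + 1) ^ 2 - (X' + t) * (X' - t) ^ 2 := by
    rw [hxm, sub_mul, div_mul_cancel₀ _ hXt]
  constructor
  · linear_combination hp + hm + 2 * hcurve
  · apply mul_right_cancel₀ hXt
    linear_combination (xm * (X' - t) ^ 2) * hp +
      ((t ^ 3 + a * t + b) * (Y' - 1) ^ 2 - (X' + t) * (X' - t) ^ 2) * hm +
      ((t ^ 3 + a * t + b) * Y' ^ 2 + (X' ^ 3 + a * X' + b) - 2 * (t ^ 3 + a * t + b) -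
        2 * ((X' + t) * (X' - t) ^ 2)) * hcurve

end Formulas



/-! ### Doubling `Q` -/

section Doubling

/-- `φ₂ = X⁴ - 2aX² - 8bX + a²`, the numerator of the duplication formula
`x(2P) = φ₂(x)/(4(x³ + ax + b))`. [folklore] -/
noncomputable def phi2 : F[X] := X ^ 4 - 2 * C E.a₄ * X ^ 2 - 8 * C E.a₆ * X + C E.a₄ ^ 2

omit [E.IsShortNF] [E.IsElliptic] in
/-- `deg φ₂ = 4`. [folklore] -/
theorem natDegree_phi2 : (phi2 E).natDegree = 4 := by
  rw [phi2]; compute_degree!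

omit [E.IsShortNF] [E.IsElliptic] in
/-- The Bézout identity `(3X² + 4a) φ₂ - (3X³ - 5aX - 27b)(X³ + aX + b) = 4a³ + 27b²`. [folklore] -/
theorem phi2_bezout : (3 * X ^ 2 + 4 * C E.a₄) * phi2 E - (3 * X ^ 3 - 5 * C E.a₄ * X - 27 * C E.a₆) * cubic E =
    C (4 * E.a₄ ^ 3 + 27 * E.a₆ ^ 2) := by
  simp only [phi2, cubic, map_add, map_mul, map_pow, map_ofNat]
  ring

/-- `4a³ + 27b² ≠ 0` for an elliptic curve in short Weierstrass form (`Δ = -16(4a³ + 27b²)`).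
[folklore] -/
theorem four_mul_a₄_pow_add_ne_zero : 4 * E.a₄ ^ 3 + 27 * E.a₆ ^ 2 ≠ 0 := by
  intro h
  apply E.Δ'.ne_zero
  rw [E.coe_Δ', E.Δ_of_isShortNF, h, mul_zero]

/-- `φ₂ = X⁴ - 2aX² - 8bX + a²` and `X³ + aX + b` are coprime when `4a³ + 27b² ≠ 0`, by the explicit
Bézout identity `phi2_bezout`. [folklore] -/
theorem isCoprime_phi2_cubic : IsCoprime (phi2 E) (cubic E) := by
  set δ := 4 * E.a₄ ^ 3 + 27 * E.a₆ ^ 2 with hδ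
  have hδ0 : δ ≠ 0 := four_mul_a₄_pow_add_ne_zero E
  have hinv : C δ⁻¹ * C δ = (1 : F[X]) := by rw [← C_mul, inv_mul_cancel₀ hδ0, C_1]
  refine ⟨C δ⁻¹ * (3 * X ^ 2 + 4 * C E.a₄), -(C δ⁻¹ * (3 * X ^ 3 - 5 * C E.a₄ * X - 27 * C E.a₆)), ?_⟩
  linear_combination (C δ⁻¹) * phi2_bezout E + hinv

variable {E} in
omit [E.IsShortNF] [E.IsElliptic] in
/-- `2 ≠ 0` in `F(t)` when `2 ≠ 0` in `F`. [folklore] -/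
theorem two_ne_zero_ratFunc (h2 : (2 : F) ≠ 0) : (2 : RatFunc F) ≠ 0 := by
  have : RatFunc.C (2 : F) ≠ 0 := (_root_.map_ne_zero RatFunc.C).mpr h2
  simpa only [map_ofNat] using this

omit [E.IsShortNF] [E.IsElliptic] in
/-- `Q ≠ -Q`, i.e. `ℓ² ≠ -ℓ²`, in characteristic `≠ 2`. [folklore] -/
theorem Q_ne_neg_Q (h2 : (2 : F) ≠ 0) :
    ell E ^ 2 ≠ (twist E).toAffine.negY (ell E * RatFunc.X) (ell E ^ 2) := by
  simp only [WeierstrassCurve.Affine.negY, twist_a₁, twist_a₃, zero_mul, sub_zero]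
  intro h
  have : (2 : RatFunc F) * ell E ^ 2 = 0 := by linear_combination h
  exact mul_ne_zero (two_ne_zero_ratFunc h2) (pow_ne_zero 2 (ell_ne_zero E)) this

omit [E.IsShortNF] [E.IsElliptic] in
/-- The tangent slope of the twist at `Q` is `(3t² + a)/2`. [folklore] -/
theorem slope_Q_Q (h2 : (2 : F) ≠ 0) :
    (twist E).toAffine.slope (ell E * RatFunc.X) (ell E * RatFunc.X) (ell E ^ 2) (ell E ^ 2) =
      (3 * RatFunc.X ^ 2 + RatFunc.C E.a₄) / 2 := by
  rw [WeierstrassCurve.Affine.slope_of_Y_ne rfl (Q_ne_neg_Q E h2)]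
  simp only [WeierstrassCurve.Affine.negY, twist_a₁, twist_a₂, twist_a₃, twist_a₄, zero_mul,
    sub_zero, mul_zero, add_zero]
  have hℓ := ell_ne_zero E
  have h2' := two_ne_zero_ratFunc h2
  have hden : ell E ^ 2 - -(ell E ^ 2) ≠ 0 := by
    rw [sub_neg_eq_add, ← two_mul]; exact mul_ne_zero h2' (pow_ne_zero 2 hℓ)
  rw [div_eq_div_iff hden h2']
  ring

omit [E.IsShortNF] [E.IsElliptic] in
/-- `x(2Q)/ℓ = φ₂(t)/(4 ℓ) = ((t² - a)² - 8bt)/(4(t³ + at + b))` (Knapp's recomputation of (3.74)).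
[cite: Knapp1993, Lemma 10.8] -/
theorem addX_Q_Q_div (h2 : (2 : F) ≠ 0) :
    (twist E).toAffine.addX (ell E * RatFunc.X) (ell E * RatFunc.X)
        ((twist E).toAffine.slope (ell E * RatFunc.X) (ell E * RatFunc.X) (ell E ^ 2) (ell E ^ 2)) /
          ell E =
      algebraMap F[X] (RatFunc F) (phi2 E) / algebraMap F[X] (RatFunc F) (4 * cubic E) := by
  rw [slope_Q_Q E h2]
  simp only [WeierstrassCurve.Affine.addX, twist_a₁, twist_a₂, map_mul, map_ofNat, algebraMap_cubic,
    zero_mul, add_zero, sub_zero]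
  have hℓ := ell_ne_zero E
  have h2' := two_ne_zero_ratFunc h2
  have h4 : (4 : RatFunc F) ≠ 0 := by
    rw [show (4 : RatFunc F) = 2 * 2 by norm_num]; exact mul_ne_zero h2' h2'
  have hphi : algebraMap F[X] (RatFunc F) (phi2 E) = RatFunc.X ^ 4 - 2 * RatFunc.C E.a₄ * RatFunc.X ^ 2 -
      8 * RatFunc.C E.a₆ * RatFunc.X + RatFunc.C E.a₄ ^ 2 := by simp [phi2, map_ofNat]
  rw [hphi, div_eq_div_iff hℓ (mul_ne_zero h4 hℓ)]
  simp only [ell]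
  field_simp
  ring

/-- `d(2Q) = 4`: `x(2Q)/ℓ = ((t² - a)² - 8bt)/(4(t³ + at + b))` in lowest terms (Knapp's recomputation of
(3.74) in the proof of Lemma 10.8; lowest terms because `Δ ≠ 0`). [cite: Knapp1993, Lemma 10.8] -/
theorem pdeg_Q_add_Q (h2 : (2 : F) ≠ 0) : pdeg E (Q E + Q E) = 4 := by
  rw [Q, WeierstrassCurve.Affine.Point.add_self_of_Y_ne (Q_ne_neg_Q E h2), pdeg_some,
    addX_Q_Q_div E h2]
  have h4 : (4 : F) ≠ 0 := by
    rw [show (4 : F) = 2 * 2 by norm_num]; exact mul_ne_zero h2 h2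
  have hu : IsUnit (4 : F[X]) := by
    rw [show (4 : F[X]) = C 4 from (map_ofNat C 4).symm]
    exact isUnit_C.mpr (Ne.isUnit h4)
  rw [RatFunc.height_eq_of_isCoprime (mul_ne_zero hu.ne_zero (cubic_ne_zero E))
    ((isCoprime_mul_unit_left_right hu _ _).mpr (isCoprime_phi2_cubic E)) rfl, natDegree_phi2,
    show (4 : F[X]) = C 4 from (map_ofNat C 4).symm, natDegree_C_mul h4, natDegree_cubic]
  norm_num

end Doubling

/-! ### Lemma 10.8: the parallelogram identity with `Q` -/

/-- **Knapp's Lemma 10.8** (the corrected form of Manin's basic identity, valid for every point `P` of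
the twist, not only for the `Z_n`): `d(P + Q) + d(P - Q) = 2 d(P) + 2`, where `Q = (ℓt, ℓ²)` and
`d` is the larger of the degrees of numerator and denominator of `x/ℓ` in lowest terms. Cases
`P = O`, `P = ±Q` by direct computation (`pdeg_Q`, `pdeg_Q_add_Q`); otherwise by
`height_add_height` applied to the sum and product of `x(P ± Q)/ℓ` (`sum_prod_addX`).
[cite: Knapp1993, Lemma 10.8] -/
theorem pdeg_add_Q_add_pdeg_sub_Q (h2 : (2 : F) ≠ 0) (P : (twist E).toAffine.Point) :
    pdeg E (P + Q E) + pdeg E (P - Q E) = 2 * pdeg E P + 2 := by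
  rcases P with _ | ⟨x, y, hP⟩
  · rw [← WeierstrassCurve.Affine.Point.zero_def, zero_add, zero_sub, pdeg_neg, pdeg_Q, pdeg_zero]
  · obtain ⟨X', rfl⟩ : ∃ X', x = ell E * X' := ⟨x / ell E, (mul_div_cancel₀ _ (ell_ne_zero E)).symm⟩
    obtain ⟨Y', rfl⟩ : ∃ Y', y = ell E ^ 2 * Y' :=
      ⟨y / ell E ^ 2, (mul_div_cancel₀ _ (pow_ne_zero 2 (ell_ne_zero E))).symm⟩
    have hcurve := (twist_nonsingular_iff' X' Y').mp hP
    by_cases hX : X' = RatFunc.X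
    · subst hX
      have hℓ : ell E = RatFunc.X ^ 3 + RatFunc.C E.a₄ * RatFunc.X + RatFunc.C E.a₆ := rfl
      have hY : (Y' - 1) * (Y' + 1) = 0 := by
        apply mul_left_cancel₀ (ell_ne_zero E)
        linear_combination hcurve - hℓ
      rcases mul_eq_zero.mp hY with hY | hY
      · -- `P = Q`
        have hY1 : Y' = 1 := sub_eq_zero.mp hY
        subst hY1
        have hPQ : WeierstrassCurve.Affine.Point.some _ _ hP = Q E := by
          simp only [Q, mul_one]
        rw [hPQ, sub_self, pdeg_zero, pdeg_Q_add_Q E h2, pdeg_Q]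
      · -- `P = -Q`
        have hY1 : Y' = -1 := eq_neg_of_add_eq_zero_left hY
        subst hY1
        have hPQ : WeierstrassCurve.Affine.Point.some _ _ hP = -Q E := by
          simp only [Q, WeierstrassCurve.Affine.Point.neg_some, WeierstrassCurve.Affine.negY,
            twist_a₁, twist_a₃, zero_mul, sub_zero, mul_neg, mul_one]
        rw [hPQ, neg_add_cancel, pdeg_zero, show -Q E - Q E = -(Q E + Q E) by abel, pdeg_neg,
          pdeg_Q_add_Q E h2, pdeg_neg, pdeg_Q]
    · have hne : ell E * X' ≠ ell E * RatFunc.X := fun h => hX (mul_left_cancel₀ (ell_ne_zero E) h)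
      rw [Q, WeierstrassCurve.Affine.Point.add_of_X_ne hne, sub_eq_add_neg,
        WeierstrassCurve.Affine.Point.neg_some, WeierstrassCurve.Affine.Point.add_of_X_ne hne]
      simp only [pdeg_some]
      rw [addX_Q_div Y' hX, addX_negQ_div Y' hX, mul_div_cancel_left₀ _ (ell_ne_zero E)]
      obtain ⟨hs, hp⟩ := sum_prod_addX hX hcurve
      exact height_add_height hX hs hp


/-! ### The Frobenius point and Lemma 10.7 -/

section Frobenius

variable [Fintype F]

omit [E.IsShortNF] [E.IsElliptic] in
/-- Frobenius on the cubic: `(X³ + aX + b)^q = X^{3q} + a X^q + b` over a field with `q` elements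
(Mathlib's `FiniteField.expand_card`). [folklore] -/
theorem cubic_pow_card :
    cubic E ^ Fintype.card F = X ^ (3 * Fintype.card F) + C E.a₄ * X ^ Fintype.card F + C E.a₆ := by
  rw [← FiniteField.expand_card, cubic]
  simp only [map_add, map_mul, map_pow, expand_X, expand_C]
  ring

omit [E.IsShortNF] [E.IsElliptic] in
variable {E} in
/-- `q = 2 (q / 2) + 1` for a finite field of odd characteristic. [folklore] -/
theorem card_eq_two_mul_add_one (hF : ringChar F ≠ 2) :
    Fintype.card F = 2 * (Fintype.card F / 2) + 1 :=
  (Nat.two_mul_div_two_add_one_of_odd (Nat.odd_iff.mpr (FiniteField.odd_card_of_char_ne_two hF))).symm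

omit [E.IsShortNF] [E.IsElliptic] in
/-- Frobenius: `ℓ(t)^q = ℓ(t^q) = t^{3q} + a t^q + b` in `F(t)`. [folklore] -/
theorem ell_pow_card :
    ell E ^ Fintype.card F = RatFunc.X ^ (3 * Fintype.card F) +
      RatFunc.C E.a₄ * RatFunc.X ^ Fintype.card F + RatFunc.C E.a₆ := by
  have := congrArg (algebraMap F[X] (RatFunc F)) (cubic_pow_card E)
  simpa [algebraMap_cubic] using this

/-- `Frob = (ℓ t^q, ℓ² · ℓ^{(q-1)/2})` lies on the twist (Knapp's solution
`(X, Y) = (x^p, (x³ + ax + b)^{(p-1)/2})` of (10.13)), because `ℓ^q = ℓ(t^q)`. [cite: Knapp1993, (10.13)] -/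
theorem nonsingular_frob (hF : ringChar F ≠ 2) :
    (twist E).toAffine.Nonsingular (ell E * RatFunc.X ^ Fintype.card F)
      (ell E ^ 2 * ell E ^ (Fintype.card F / 2)) := by
  rw [twist_nonsingular_iff']
  have hq := card_eq_two_mul_add_one (F := F) hF
  calc ell E * (ell E ^ (Fintype.card F / 2)) ^ 2 = ell E ^ (2 * (Fintype.card F / 2) + 1) := by ring
    _ = ell E ^ Fintype.card F := by rw [← hq]
    _ = _ := ell_pow_card E
    _ = _ := by ring

/-- The Frobenius point `Frob = (ℓ t^q, ℓ^{(q+3)/2})` of the twist. [cite: Knapp1993, (10.14)] -/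
noncomputable def frob (hF : ringChar F ≠ 2) : (twist E).toAffine.Point :=
  .some _ _ (nonsingular_frob E hF)

/-- `d(Frob) = q` (`x(Frob)/ℓ = t^q`; Knapp: `d_0 = p`). [cite: Knapp1993, Lemma 10.7] -/
theorem pdeg_frob (hF : ringChar F ≠ 2) : pdeg E (frob E hF) = Fintype.card F := by
  rw [frob, pdeg_some, mul_div_cancel_left₀ _ (ell_ne_zero E), ← RatFunc.algebraMap_X, ← map_pow,
    RatFunc.height_algebraMap, natDegree_X_pow]

omit [E.IsShortNF] [E.IsElliptic] in
/-- `t^q ≠ t` in `F(t)`. [folklore] -/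
theorem X_pow_card_ne_X : (RatFunc.X : RatFunc F) ^ Fintype.card F ≠ RatFunc.X := by
  intro h
  have h' : algebraMap F[X] (RatFunc F) (X ^ Fintype.card F - X) = 0 := by
    rw [map_sub, map_pow, RatFunc.algebraMap_X, h, sub_self]
  exact FiniteField.X_pow_card_sub_X_ne_zero F Fintype.one_lt_card
    ((map_eq_zero_iff _ (RatFunc.algebraMap_injective F)).mp h')

/-- `M = ℓ (ℓ^{(q-1)/2} + 1)² - (X^q + X)(X^q - X)²`, the numerator of `X_{-1} = x(Frob - Q)/ℓ` (Knapp's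
(10.16) over the common denominator `(x - x^p)²`). [cite: Knapp1993, (10.16)] -/
noncomputable def frobNum : F[X] :=
  cubic E * (cubic E ^ (Fintype.card F / 2) + 1) ^ 2 -
    (X ^ Fintype.card F + X) * (X ^ Fintype.card F - X) ^ 2

/-- `(X^q - X)²`, the denominator of `X_{-1}` in (10.16). [cite: Knapp1993, (10.16)] -/
noncomputable def frobDen : F[X] := (X ^ Fintype.card F - X) ^ 2

/-- `d(Frob - Q)` is the height of `M/(t^q - t)²`, `M = ℓ (ℓ^{(q-1)/2} + 1)² - (t^q + t)(t^q - t)²`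
(Knapp's (10.16), cleared of fractions). [cite: Knapp1993, (10.16)] -/
theorem pdeg_frob_sub_Q_eq_height (hF : ringChar F ≠ 2) :
    pdeg E (frob E hF - Q E) =
      (algebraMap F[X] (RatFunc F) (frobNum E) / algebraMap F[X] (RatFunc F) (frobDen (F := F))).height := by
  have hX : (RatFunc.X : RatFunc F) ^ Fintype.card F ≠ RatFunc.X := X_pow_card_ne_X
  have hne : ell E * RatFunc.X ^ Fintype.card F ≠ ell E * RatFunc.X :=
    fun h => hX (mul_left_cancel₀ (ell_ne_zero E) h)
  rw [frob, Q, sub_eq_add_neg, WeierstrassCurve.Affine.Point.neg_some,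
    WeierstrassCurve.Affine.Point.add_of_X_ne hne, pdeg_some, addX_negQ_div _ hX]
  congr 1
  have hD : algebraMap F[X] (RatFunc F) (frobDen (F := F)) ≠ 0 :=
    RatFunc.algebraMap_ne_zero (pow_ne_zero 2 (FiniteField.X_pow_card_sub_X_ne_zero F Fintype.one_lt_card))
  rw [eq_div_iff hD]
  simp only [frobNum, frobDen, map_sub, map_mul, map_pow, map_add, map_one, RatFunc.algebraMap_X,
    algebraMap_cubic]
  have hXt : (RatFunc.X ^ Fintype.card F - RatFunc.X : RatFunc F) ^ 2 ≠ 0 :=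
    pow_ne_zero 2 (sub_ne_zero.mpr hX)
  rw [sub_mul, div_mul_cancel₀ _ hXt]

end Frobenius

/-! ### Counting: the height of `x(Frob - Q)/ℓ` is `#E(F)` -/

section Count

variable [Fintype F]

omit [E.IsShortNF] [E.IsElliptic] [Fintype F] in
/-- `ℓ(j) = j³ + a j + b`. [folklore] -/
theorem eval_cubic (j : F) : (cubic E).eval j = j ^ 3 + E.a₄ * j + E.a₆ := by
  simp [cubic]

/-- The number of `y ∈ F` with `y² = j³ + a j + b` (so `#E(F) = 1 + Σ_j numY j`). [folklore] -/
noncomputable def numY (j : F) : ℕ := (Finset.univ.filter fun y : F => y ^ 2 = (cubic E).eval j).card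

omit [E.IsShortNF] [E.IsElliptic] in
/-- `#{y : y² = ℓ(j)} = χ(ℓ(j)) + 1` for the quadratic character `χ` (Mathlib's
`quadraticChar_card_sqrts`). [folklore] -/
theorem numY_eq (hF : ringChar F ≠ 2) (j : F) :
    (numY E j : ℤ) = quadraticChar F ((cubic E).eval j) + 1 := by
  rw [← quadraticChar_card_sqrts hF, numY, Set.toFinset_setOf]

omit [E.IsShortNF] [E.IsElliptic] in
/-- If `ℓ(j) = 0` there is exactly one `y` (namely `0`). [folklore] -/
theorem numY_of_eval_eq_zero (hF : ringChar F ≠ 2) {j : F} (h : (cubic E).eval j = 0) : numY E j = 1 := by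
  have := numY_eq E hF j
  rw [h, quadraticChar_zero, zero_add] at this
  exact_mod_cast this

omit [E.IsShortNF] [E.IsElliptic] in
/-- If `ℓ(j)` is a nonzero square there are exactly two `y`. [folklore] -/
theorem numY_of_isSquare (hF : ringChar F ≠ 2) {j : F} (h0 : (cubic E).eval j ≠ 0)
    (hs : IsSquare ((cubic E).eval j)) : numY E j = 2 := by
  have := numY_eq E hF j
  rw [(quadraticChar_one_iff_isSquare h0).mpr hs] at this
  exact_mod_cast this

omit [E.IsShortNF] [E.IsElliptic] in
/-- If `ℓ(j)` is a non-square there is no `y`. [folklore] -/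
theorem numY_of_not_isSquare (hF : ringChar F ≠ 2) {j : F} (hs : ¬IsSquare ((cubic E).eval j)) :
    numY E j = 0 := by
  have := numY_eq E hF j
  rw [quadraticChar_neg_one_iff_not_isSquare.mpr hs] at this
  simpa using this

omit [E.IsShortNF] [E.IsElliptic] in
/-- `#{y : y² = ℓ(j)} ≤ 2`. [folklore] -/
theorem numY_le_two (hF : ringChar F ≠ 2) (j : F) : numY E j ≤ 2 := by
  by_cases h0 : (cubic E).eval j = 0
  · rw [numY_of_eval_eq_zero E hF h0]; norm_num
  by_cases hs : IsSquare ((cubic E).eval j)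
  · rw [numY_of_isSquare E hF h0 hs]
  · rw [numY_of_not_isSquare E hF hs]; norm_num

omit [E.IsShortNF] [E.IsElliptic] in
/-- `X - j ∣ X^q - X` for every `j ∈ F`. [folklore] -/
theorem X_sub_C_dvd_X_pow_card_sub_X (j : F) : X - C j ∣ (X ^ Fintype.card F - X : F[X]) :=
  dvd_iff_isRoot.mpr (by simp [FiniteField.pow_card])

omit [E.IsShortNF] [E.IsElliptic] in
/-- `q / 2 ≥ 1`. [folklore] -/
theorem card_div_two_pos : 0 < Fintype.card F / 2 :=
  Nat.div_pos Fintype.one_lt_card two_pos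

omit [Fintype F] in
/-- If `j³ + a j + b = 0` then `3j² + a ≠ 0`: `X³ + aX + b` is squarefree since `4a³ + 27b² ≠ 0`.
[folklore] -/
theorem three_mul_sq_add_ne_zero {j : F} (h : (cubic E).eval j = 0) : 3 * j ^ 2 + E.a₄ ≠ 0 := by
  intro h'
  apply four_mul_a₄_pow_add_ne_zero E
  rw [eval_cubic] at h
  linear_combination (27 * (j ^ 3 + E.a₄ * j + E.a₆) - 54 * (j ^ 3 + E.a₄ * j)) * h +
    (4 * (3 * j ^ 2 + E.a₄) ^ 2 - 9 * j ^ 2 * (3 * j ^ 2 + E.a₄)) * h'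

omit [E.IsShortNF] [E.IsElliptic] [Fintype F] in
/-- If `(X - j)² ∣ p` then `p'(j) = 0`. [folklore] -/
theorem eval_derivative_eq_zero_of_sq_dvd {p : F[X]} {j : F} (h : (X - C j) ^ 2 ∣ p) :
    (derivative p).eval j = 0 := by
  obtain ⟨k, rfl⟩ := h
  simp [derivative_mul, derivative_pow]

omit [E.IsShortNF] [E.IsElliptic] in
/-- `(X - j)^{2 - numY j} ∣ M`: at a non-square value `ℓ(j)`, Euler's criterion gives
`ℓ(j)^{(q-1)/2} = -1`, so `X - j ∣ ℓ^{(q-1)/2} + 1`; at a root of `ℓ`, `M(j) = 0` (Knapp's count of the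
factors `x - j` cancelling in (10.16)). [cite: Knapp1993, Lemma 10.7] -/
theorem pow_dvd_frobNum (hF : ringChar F ≠ 2) (j : F) : (X - C j) ^ (2 - numY E j) ∣ frobNum E := by
  by_cases h0 : (cubic E).eval j = 0
  · rw [numY_of_eval_eq_zero E hF h0, show 2 - 1 = 1 from rfl, pow_one, dvd_iff_isRoot]
    simp [frobNum, h0, FiniteField.pow_card]
  by_cases hs : IsSquare ((cubic E).eval j)
  · rw [numY_of_isSquare E hF h0 hs]
    simp
  · rw [numY_of_not_isSquare E hF hs, Nat.sub_zero, frobNum]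
    have hm1 : (cubic E).eval j ^ (Fintype.card F / 2) = -1 :=
      (FiniteField.pow_dichotomy hF h0).resolve_left fun h => hs ((FiniteField.isSquare_iff hF h0).mpr h)
    have h1 : X - C j ∣ cubic E ^ (Fintype.card F / 2) + 1 :=
      dvd_iff_isRoot.mpr (by simp [hm1])
    exact dvd_sub (dvd_mul_of_dvd_right (pow_dvd_pow_of_dvd h1 2) _)
      (dvd_mul_of_dvd_right (pow_dvd_pow_of_dvd (X_sub_C_dvd_X_pow_card_sub_X j) 2) _)

/-- If `numY j > 0` then `(X - j)^{3 - numY j} ∤ M`: at a nonzero square `ℓ(j)`, `M(j) = 4 ℓ(j) ≠ 0`; at a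
root `j` of `ℓ`, `(X - j)² ∣ M` would force `ℓ'(j) = 3j² + a = 0` (Knapp: "in this case `x - j` occurs
as a factor of the numerator exactly once"). [cite: Knapp1993, Lemma 10.7] -/
theorem not_pow_succ_dvd_frobNum (hF : ringChar F ≠ 2) (j : F) (hpos : 0 < numY E j) :
    ¬(X - C j) ^ (2 - numY E j + 1) ∣ frobNum E := by
  have h2 : (2 : F) ≠ 0 := Ring.two_ne_zero hF
  by_cases h0 : (cubic E).eval j = 0
  · rw [numY_of_eval_eq_zero E hF h0]
    intro hdvd
    have hdvd' : (X - C j) ^ 2 ∣ cubic E * (cubic E ^ (Fintype.card F / 2) + 1) ^ 2 := by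
      have : cubic E * (cubic E ^ (Fintype.card F / 2) + 1) ^ 2 =
          frobNum E + (X ^ Fintype.card F + X) * (X ^ Fintype.card F - X) ^ 2 := by
        rw [frobNum]; ring
      rw [this]
      exact dvd_add hdvd
        (dvd_mul_of_dvd_right (pow_dvd_pow_of_dvd (X_sub_C_dvd_X_pow_card_sub_X j) 2) _)
    have hder := eval_derivative_eq_zero_of_sq_dvd hdvd'
    rw [derivative_mul, eval_add, eval_mul, eval_mul, h0, zero_mul, add_zero] at hder
    have hc' : (derivative (cubic E)).eval j = 3 * j ^ 2 + E.a₄ := by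
      simp [cubic]; norm_num
    rw [hc', eval_pow, eval_add, eval_pow, h0, zero_pow card_div_two_pos.ne', zero_add, eval_one,
      one_pow, mul_one] at hder
    exact three_mul_sq_add_ne_zero E h0 hder
  by_cases hs : IsSquare ((cubic E).eval j)
  · rw [numY_of_isSquare E hF h0 hs, Nat.sub_self, zero_add, pow_one, dvd_iff_isRoot]
    have h1 : (cubic E).eval j ^ (Fintype.card F / 2) = 1 := (FiniteField.isSquare_iff hF h0).mp hs
    have hev : (frobNum E).eval j = 4 * (cubic E).eval j := by
      simp only [frobNum, eval_sub, eval_mul, eval_pow, eval_add, eval_one, eval_X,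
        FiniteField.pow_card, sub_self, h1]
      ring
    have h4 : (4 : F) ≠ 0 := by
      rw [show (4 : F) = 2 * 2 by norm_num]; exact mul_ne_zero h2 h2
    rw [IsRoot.def, hev]
    exact mul_ne_zero h4 h0
  · rw [numY_of_not_isSquare E hF hs] at hpos
    exact absurd hpos (lt_irrefl 0)

/-- `G = ∏_j (X - j)^{2 - numY j}`, the greatest common factor of `M` and `(X^q - X)²`. [folklore] -/
noncomputable def frobGcd : F[X] := ∏ j : F, (X - C j) ^ (2 - numY E j)

/-- `D' = ∏_j (X - j)^{numY j}`, the denominator of `X_{-1}` in lowest terms (Knapp: the factors that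
remain in the denominator correspond exactly to the affine solutions). [cite: Knapp1993, Lemma 10.7] -/
noncomputable def frobDen' : F[X] := ∏ j : F, (X - C j) ^ numY E j

omit [E.IsShortNF] [E.IsElliptic] in
/-- `X^q - X = ∏_{j ∈ F} (X - j)`. [folklore] -/
theorem X_pow_card_sub_X_eq_prod : (X ^ Fintype.card F - X : F[X]) = ∏ j : F, (X - C j) := by
  have hmonic : (X ^ Fintype.card F - X : F[X]).Monic :=
    monic_X_pow_sub (by rw [degree_X]; exact_mod_cast Fintype.one_lt_card)
  have h := prod_multiset_X_sub_C_of_monic_of_roots_card_eq hmonic (by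
    rw [FiniteField.roots_X_pow_card_sub_X, FiniteField.X_pow_card_sub_X_natDegree_eq _ Fintype.one_lt_card]
    rfl)
  rw [FiniteField.roots_X_pow_card_sub_X] at h
  rw [← h]
  rfl

omit [E.IsShortNF] [E.IsElliptic] in
/-- `(X^q - X)² = ∏_{j ∈ F} (X - j)²`. [folklore] -/
theorem frobDen_eq_prod : (frobDen : F[X]) = ∏ j : F, (X - C j) ^ 2 := by
  rw [frobDen, X_pow_card_sub_X_eq_prod, Finset.prod_pow]

omit [E.IsShortNF] [E.IsElliptic] in
/-- `(X^q - X)² = G · D'` with `G = ∏ (X - j)^{2 - numY j}`, `D' = ∏ (X - j)^{numY j}`. [folklore] -/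
theorem frobDen_eq_mul (hF : ringChar F ≠ 2) : (frobDen : F[X]) = frobGcd E * frobDen' E := by
  rw [frobDen_eq_prod, frobGcd, frobDen', ← Finset.prod_mul_distrib]
  refine Finset.prod_congr rfl fun j _ => ?_
  rw [← pow_add, Nat.sub_add_cancel (numY_le_two E hF j)]

omit [E.IsShortNF] [E.IsElliptic] in
/-- `G = ∏ (X - j)^{2 - numY j}` divides `M` (the factors are pairwise coprime). This and
`not_pow_succ_dvd_frobNum` are Knapp's count of the linear factors surviving in the denominator of
`X_{-1}`. [cite: Knapp1993, Lemma 10.7] -/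
theorem frobGcd_dvd (hF : ringChar F ≠ 2) : frobGcd E ∣ frobNum E := by
  refine Finset.prod_dvd_of_coprime ?_ fun j _ => pow_dvd_frobNum E hF j
  have := pairwise_coprime_X_sub_C (K := F) Function.injective_id
  exact (this.set_pairwise _).mono' fun i j h => IsCoprime.pow h

omit [E.IsShortNF] [E.IsElliptic] in
/-- `G` is monic. [folklore] -/
theorem monic_frobGcd : (frobGcd E).Monic :=
  monic_prod_of_monic _ _ fun j _ => (monic_X_sub_C j).pow _

omit [E.IsShortNF] [E.IsElliptic] in
/-- `D'` is monic. [folklore] -/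
theorem monic_frobDen' : (frobDen' E).Monic :=
  monic_prod_of_monic _ _ fun j _ => (monic_X_sub_C j).pow _

omit [E.IsShortNF] [E.IsElliptic] in
/-- `deg G + Σ_j numY j = 2q`. [folklore] -/
theorem natDegree_frobGcd_add (hF : ringChar F ≠ 2) :
    (frobGcd E).natDegree + ∑ j : F, numY E j = 2 * Fintype.card F := by
  rw [frobGcd, natDegree_prod_of_monic _ _ fun j _ => (monic_X_sub_C j).pow _]
  simp only [natDegree_pow, natDegree_X_sub_C, mul_one]
  rw [← Finset.sum_add_distrib, Finset.sum_congr rfl fun j _ => Nat.sub_add_cancel (numY_le_two E hF j)]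
  simp [mul_comm]

omit [E.IsShortNF] [E.IsElliptic] in
/-- `deg (X^q - X)² = 2q`. [folklore] -/
theorem natDegree_frobDen : (frobDen : F[X]).natDegree = 2 * Fintype.card F := by
  rw [frobDen, natDegree_pow, FiniteField.X_pow_card_sub_X_natDegree_eq _ Fintype.one_lt_card]

omit [E.IsShortNF] [E.IsElliptic] in
/-- `deg M = 2q + 1`: `M = X^{2q+1} + (terms of degree ≤ 2q)` since `ℓ^q = ℓ(X^q)` (Knapp: the numerator of
`X_{-1}` is `x^{2p+1} + R(x)`, `deg R ≤ 2p`). [cite: Knapp1993, Lemma 10.7] -/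
theorem natDegree_frobNum (hF : ringChar F ≠ 2) : (frobNum E).natDegree = 2 * Fintype.card F + 1 := by
  set m := Fintype.card F / 2 with hm
  have hq : Fintype.card F = 2 * m + 1 := card_eq_two_mul_add_one hF
  have hm1 : 1 ≤ m := card_div_two_pos
  have h1 := cubic_pow_card E
  rw [hq] at h1
  have key : frobNum E = X ^ (2 * (2 * m + 1) + 1) +
      (X ^ (2 * m + 3) - X ^ 3 + C E.a₄ * X ^ (2 * m + 1) + C E.a₆ + 2 * cubic E ^ (m + 1) + cubic E) := by
    rw [frobNum, ← hm, hq]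
    linear_combination h1
  rw [hq, key, natDegree_add_eq_left_of_natDegree_lt] <;> rw [natDegree_X_pow]
  have hc : (cubic E ^ (m + 1)).natDegree = 3 * (m + 1) := by rw [natDegree_pow, natDegree_cubic]; ring
  have h2c : (2 * cubic E ^ (m + 1)).natDegree ≤ 3 * (m + 1) := by
    calc (2 * cubic E ^ (m + 1)).natDegree ≤ (2 : F[X]).natDegree + (cubic E ^ (m + 1)).natDegree :=
          natDegree_mul_le
      _ ≤ 0 + 3 * (m + 1) := add_le_add (by simp) hc.le
      _ = 3 * (m + 1) := zero_add _
  have haX : (C E.a₄ * X ^ (2 * m + 1)).natDegree ≤ 2 * m + 1 :=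
    (natDegree_C_mul_le _ _).trans (natDegree_X_pow_le _)
  calc (X ^ (2 * m + 3) - X ^ 3 + C E.a₄ * X ^ (2 * m + 1) + C E.a₆ + 2 * cubic E ^ (m + 1) +
          cubic E).natDegree
      ≤ max (max (max (max (max (X ^ (2 * m + 3) : F[X]).natDegree (X ^ 3 : F[X]).natDegree)
          (C E.a₄ * X ^ (2 * m + 1)).natDegree) (C E.a₆).natDegree) (2 * cubic E ^ (m + 1)).natDegree)
          (cubic E).natDegree := by
        refine (natDegree_add_le _ _).trans (max_le_max_right _ ?_)
        refine (natDegree_add_le _ _).trans (max_le_max_right _ ?_)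
        refine (natDegree_add_le _ _).trans (max_le_max_right _ ?_)
        refine (natDegree_add_le _ _).trans (max_le_max_right _ ?_)
        exact natDegree_sub_le _ _
    _ < 2 * (2 * m + 1) + 1 := by
        simp only [natDegree_X_pow, natDegree_C, natDegree_cubic]
        omega

omit [E.IsShortNF] [E.IsElliptic] in
/-- `M ≠ 0`. [folklore] -/
theorem frobNum_ne_zero (hF : ringChar F ≠ 2) : frobNum E ≠ 0 := by
  intro h
  have := natDegree_frobNum E hF
  rw [h, natDegree_zero] at this
  omega

/-- The height of `X_{-1} = M/(X^q - X)²` is `1 + Σ_j numY j`: in lowest terms `X_{-1} = M'/D'` with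
`M = G M'`, `deg M' = deg D' + 1` and `deg D' = Σ_j numY j` (Knapp's (10.15): `d_{-1} = N_p + 1`).
[cite: Knapp1993, Lemma 10.7] -/
theorem height_frobNum_div (hF : ringChar F ≠ 2) :
    (algebraMap F[X] (RatFunc F) (frobNum E) / algebraMap F[X] (RatFunc F) (frobDen (F := F))).height =
      1 + ∑ j : F, numY E j := by
  obtain ⟨M', hM⟩ := frobGcd_dvd E hF
  have hD := frobDen_eq_mul E hF
  have hG0 : frobGcd E ≠ 0 := (monic_frobGcd E).ne_zero
  have hD'0 : frobDen' E ≠ 0 := (monic_frobDen' E).ne_zero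
  have hM'0 : M' ≠ 0 := by
    rintro rfl
    exact frobNum_ne_zero E hF (by simpa using hM)
  -- coprimality of the reduced fraction
  have hcop : IsCoprime M' (frobDen' E) := by
    refine IsCoprime.prod_right fun j _ => ?_
    by_cases hj : numY E j = 0
    · rw [hj, pow_zero]
      exact isCoprime_one_right
    · apply IsCoprime.pow_right
      refine ((irreducible_X_sub_C j).coprime_iff_not_dvd.mpr ?_).symm
      intro hdvd
      apply not_pow_succ_dvd_frobNum E hF j (Nat.pos_of_ne_zero hj)
      rw [hM, frobGcd, ← Finset.mul_prod_erase _ _ (Finset.mem_univ j), pow_succ, mul_assoc]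
      exact mul_dvd_mul_left _ (dvd_mul_of_dvd_right hdvd _)
  -- reduce the fraction
  have hred : algebraMap F[X] (RatFunc F) (frobNum E) / algebraMap F[X] (RatFunc F) (frobDen (F := F)) =
      algebraMap F[X] (RatFunc F) M' / algebraMap F[X] (RatFunc F) (frobDen' E) := by
    rw [hM, hD, map_mul, map_mul, mul_div_mul_left _ _ (RatFunc.algebraMap_ne_zero hG0)]
  rw [RatFunc.height_eq_of_isCoprime hD'0 hcop hred]
  -- degrees
  have h1 : (frobGcd E).natDegree + M'.natDegree = 2 * Fintype.card F + 1 := by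
    rw [← natDegree_mul hG0 hM'0, ← hM, natDegree_frobNum E hF]
  have h2 : (frobGcd E).natDegree + (frobDen' E).natDegree = 2 * Fintype.card F := by
    rw [← natDegree_mul hG0 hD'0, ← hD, natDegree_frobDen]
  have h3 := natDegree_frobGcd_add E hF
  omega

/-- `#E(F) = 1 + Σ_j #{y : y² = j³ + a j + b}` (the point at infinity plus the affine solutions; on an
elliptic curve every solution is a nonsingular point). [folklore] -/
theorem natCard_point_eq : Nat.card E.toAffine.Point = 1 + ∑ j : F, numY E j := by
  have e : E.toAffine.Point ≃ Option {xy : F × F // E.toAffine.Nonsingular xy.1 xy.2} :=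
    WeierstrassCurve.Affine.nonsingularPointEquiv E.toAffine
  rw [Nat.card_congr e, Nat.card_eq_fintype_card, Fintype.card_option, add_comm]
  congr 1
  have e1 : {xy : F × F // E.toAffine.Nonsingular xy.1 xy.2} ≃
      {xy : F × F // xy.2 ^ 2 = (cubic E).eval xy.1} := by
    refine Equiv.subtypeEquivRight fun xy => ?_
    rw [← WeierstrassCurve.Affine.equation_iff_nonsingular, WeierstrassCurve.Affine.equation_iff,
      eval_cubic, E.a₁_of_isShortNF, E.a₂_of_isShortNF, E.a₃_of_isShortNF]
    constructor <;> intro h <;> linear_combination h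
  rw [Fintype.card_congr e1,
    Fintype.card_congr (Equiv.subtypeProdEquivSigmaSubtype fun (x y : F) => y ^ 2 = (cubic E).eval x),
    Fintype.card_sigma]
  refine Finset.sum_congr rfl fun j _ => ?_
  rw [numY, Fintype.card_subtype]

/-- **Knapp's Lemma 10.7**: `d_{-1} = d(Frob - Q) = #E(F)` (with `d_0 = q`, i.e.
`d_{-1} - d_0 - 1 = #E(F) - q - 1`). [cite: Knapp1993, Lemma 10.7] -/
theorem pdeg_frob_sub_Q (hF : ringChar F ≠ 2) : pdeg E (frob E hF - Q E) = Nat.card E.toAffine.Point := by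
  rw [pdeg_frob_sub_Q_eq_height, height_frobNum_div E hF, natCard_point_eq]

end Count


/-! ### The closed form and Hasse's inequality -/

section Final

variable [Fintype F]

/-- Manin's sequence `Z_n = Frob + n • Q`, `n ∈ ℤ` (Knapp's (10.14)). [cite: Knapp1993, (10.14)] -/
noncomputable def Z (hF : ringChar F ≠ 2) (n : ℤ) : (twist E).toAffine.Point := frob E hF + n • Q E

/-- The recursion `d_{n+1} + d_{n-1} = 2 d_n + 2` for `Z_n = Frob + n • Q` (Lemma 10.8 at `P = Z_n`).
[cite: Knapp1993, (10.17)] -/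
theorem pdeg_Z_rec (hF : ringChar F ≠ 2) (n : ℤ) :
    pdeg E (Z E hF (n + 1)) + pdeg E (Z E hF (n - 1)) = 2 * pdeg E (Z E hF n) + 2 := by
  have h := pdeg_add_Q_add_pdeg_sub_Q E (Ring.two_ne_zero hF) (Z E hF n)
  have e1 : Z E hF n + Q E = Z E hF (n + 1) := by
    rw [Z, Z, add_zsmul, one_zsmul, add_assoc]
  have e2 : Z E hF n - Q E = Z E hF (n - 1) := by
    rw [Z, Z, sub_zsmul, one_zsmul]
    abel
  rw [e1, e2] at h
  exact h

/-- `d_0 = q`. [cite: Knapp1993, Lemma 10.7] -/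
theorem pdeg_Z_zero (hF : ringChar F ≠ 2) : pdeg E (Z E hF 0) = Fintype.card F := by
  rw [Z, zero_zsmul, add_zero, pdeg_frob]

/-- `d_{-1} = #E(F)`. [cite: Knapp1993, Lemma 10.7] -/
theorem pdeg_Z_neg_one (hF : ringChar F ≠ 2) : pdeg E (Z E hF (-1)) = Nat.card E.toAffine.Point := by
  rw [Z, neg_one_zsmul, ← sub_eq_add_neg, pdeg_frob_sub_Q]

/-- **The closed form** `d_n = n² + a n + q` with `a = q + 1 - #E(F)`, by induction forwards and
backwards from `d_0 = q`, `d_{-1} = #E(F)` using `pdeg_Z_rec` (Knapp's (10.25)). [cite: Knapp1993, (10.25)] -/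
theorem pdeg_Z_eq (hF : ringChar F ≠ 2) (n : ℤ) :
    (pdeg E (Z E hF n) : ℤ) =
      n ^ 2 + ((Fintype.card F : ℤ) + 1 - Nat.card E.toAffine.Point) * n + Fintype.card F := by
  set N : ℤ := (Nat.card E.toAffine.Point : ℤ) with hN
  set q : ℤ := (Fintype.card F : ℤ) with hq
  set d : ℤ → ℤ := fun n => (pdeg E (Z E hF n) : ℤ) with hd
  have hrec : ∀ n, d (n + 1) + d (n - 1) = 2 * d n + 2 := fun n => by
    simp only [hd]; exact_mod_cast pdeg_Z_rec E hF n
  have h0 : d 0 = q := by simp only [hd, hq]; exact_mod_cast pdeg_Z_zero E hF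
  have h1 : d (-1) = N := by simp only [hd, hN]; exact_mod_cast pdeg_Z_neg_one E hF
  change d n = n ^ 2 + (q + 1 - N) * n + q
  suffices H : d n = n ^ 2 + (q + 1 - N) * n + q ∧ d (n - 1) = (n - 1) ^ 2 + (q + 1 - N) * (n - 1) + q from H.1
  induction n using Int.induction_on with
  | zero => exact ⟨by rw [h0]; ring, by rw [show (0 : ℤ) - 1 = -1 by norm_num, h1]; ring⟩
  | succ i ih =>
    refine ⟨?_, by rw [add_sub_cancel_right]; exact ih.1⟩
    have := hrec i
    rw [ih.1, ih.2] at this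
    linear_combination this
  | pred i ih =>
    refine ⟨ih.2, ?_⟩
    have := hrec (-(i : ℤ) - 1)
    rw [sub_add_cancel, ih.1, ih.2] at this
    linear_combination this

/-- **Hasse's inequality in integer form**: `(q + 1 - #E(F))² ≤ 4q`. From `d_n = n² + a n + q ≥ 0`
(`a = q + 1 - #E(F)`): for `a = 2k` take `n = -k`; for `a = 2k + 1` take `n = -k - 1`, which gives
`k(k+1) ≤ q`, and `k(k+1)` is even while `q` is odd (Knapp, end of the proof of Thm. 10.5, argues
instead that two consecutive `d_n` cannot vanish). [cite: Knapp1993, Thm. 10.5] -/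
theorem trace_sq_le (hF : ringChar F ≠ 2) :
    ((Fintype.card F : ℤ) + 1 - Nat.card E.toAffine.Point) ^ 2 ≤ 4 * Fintype.card F := by
  set A : ℤ := (Fintype.card F : ℤ) + 1 - Nat.card E.toAffine.Point with hA
  set q : ℤ := (Fintype.card F : ℤ) with hq
  have hnn : ∀ n : ℤ, 0 ≤ n ^ 2 + A * n + q := fun n => by
    rw [hA, hq, ← pdeg_Z_eq E hF n]; positivity
  have hodd : Odd q := by
    rw [hq, Int.odd_coe_nat, Nat.odd_iff]
    exact FiniteField.odd_card_of_char_ne_two hF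
  obtain ⟨r, hr⟩ := hodd
  rcases Int.even_or_odd A with ⟨k, hk⟩ | ⟨k, hk⟩
  · have h := hnn (-k)
    rw [hk] at h ⊢
    nlinarith [h]
  · have h := hnn (-k - 1)
    obtain ⟨j, hj⟩ := Int.even_mul_succ_self k
    have hjq : j + j ≤ 2 * r + 1 := by rw [← hj, ← hr]; rw [hk] at h; nlinarith [h]
    have hjr : j ≤ r := by omega
    rw [hk, hr]
    nlinarith [hj, hjr]

/-- **Hasse's theorem** for `E : y² = x³ + a x + b` elliptic over a finite field `F` with `q` elements
of odd characteristic: `|#E(F) - (q + 1)| ≤ 2√q` (Manin's elementary proof as in Knapp, *Elliptic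
Curves*, Thm. 10.5, there for `F = ℤ/p`, `p > 3`). [cite: Knapp1993, Thm. 10.5] -/
theorem hasse_of_isShortNF (hF : ringChar F ≠ 2) :
    |(Nat.card E.toAffine.Point : ℝ) - (Fintype.card F + 1)| ≤ 2 * Real.sqrt (Fintype.card F) := by
  have h := trace_sq_le E hF
  have h' : ((Nat.card E.toAffine.Point : ℝ) - (Fintype.card F + 1)) ^ 2 ≤ 4 * Fintype.card F := by
    rw [show ((Nat.card E.toAffine.Point : ℝ) - (Fintype.card F + 1)) ^ 2 =
        ((Fintype.card F : ℝ) + 1 - Nat.card E.toAffine.Point) ^ 2 by ring]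
    exact_mod_cast h
  calc |(Nat.card E.toAffine.Point : ℝ) - (Fintype.card F + 1)|
      ≤ Real.sqrt (4 * Fintype.card F) := Real.abs_le_sqrt h'
    _ = 2 * Real.sqrt (Fintype.card F) := by
        rw [Real.sqrt_mul (by norm_num), show (4 : ℝ) = 2 ^ 2 by norm_num,
          Real.sqrt_sq (by norm_num)]

end Final

end Literature.NumberTheory.EllipticCurves.HasseElementary

/-! ### Hasse's theorem for elliptic curves in characteristic `≠ 2, 3` -/

namespace WeierstrassCurve

variable {F : Type*} [Field F] [Fintype F] (E : WeierstrassCurve F) [E.IsElliptic]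

/-- **Hasse's theorem** (Hasse 1936; Silverman, *AEC* Thm. V.1.1: `|#E(𝔽_q) - q - 1| ≤ 2√q`) for
elliptic curves over finite fields of characteristic `≠ 2, 3`, by Manin's elementary proof (Knapp,
*Elliptic Curves*, §X.3, Thm. 10.5) applied to the short normal form `E.toShortNF • E`, which has
the same number of points (`VariableChange.pointEquiv`). Here `#E(F) = Nat.card E.toAffine.Point`
counts the affine points together with the point at infinity, as in `Literature.NumberTheory.LFunctions.hasse_bound`.
[cite: SilvermanAEC2009, Thm. V.1.1] -/
theorem abs_natCard_point_sub_le_of_ringChar_ne (h2 : ringChar F ≠ 2) (h3 : ringChar F ≠ 3) :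
    |(Nat.card E.toAffine.Point : ℝ) - (Fintype.card F + 1)| ≤ 2 * Real.sqrt (Fintype.card F) := by
  classical
  haveI : Invertible (2 : F) := invertibleOfNonzero (Ring.two_ne_zero h2)
  have h3' : (3 : F) ≠ 0 := by
    intro h
    have hdvd : ringChar F ∣ 3 := (ringChar.spec F 3).mp (by exact_mod_cast h)
    rcases (Nat.dvd_prime Nat.prime_three).mp hdvd with h1 | h1
    · exact CharP.ringChar_ne_one h1
    · exact h3 h1
  haveI : Invertible (3 : F) := invertibleOfNonzero h3'
  rw [Nat.card_congr (VariableChange.pointEquiv E E.toShortNF).toEquiv]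
  exact Literature.NumberTheory.EllipticCurves.HasseElementary.hasse_of_isShortNF (E.toShortNF • E) h2

end WeierstrassCurve
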